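import Literature.MathematicalPhysics.QuantumFieldTheory.Balaban1983to89.B15Prop1GradientFromValue
import Literature.MathematicalPhysics.QuantumFieldTheory.Balaban1983to89.B16Sect1Wilson

/-!
# `Balaban1983to89.B15Prop1GradientFromNearValue` — [Balaban1989LargeFieldI] Prop. 1 p. 194 / [Balaban1989LargeFieldII] pp. 357–359: ★★★ THE
# GRADIENT LETTER (L3) FROM (J1) AND THE NEAR-FIELD VALUE OF (1.77) — the far-field term of the typed (1.77) located and split off

Honest framing: statement-level skeleton of published theorems with citation tags; proofs where landed; nothing here is a claim about
the Yang–Mills mass gap.  Count-neutral kernel work on Bałaban AS PRINTED; NOT a discharge of node N12; nothing continuum ∕ OS ∕ mass-gap ∕ Clay.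

## What is printed

[Balaban1989LargeFieldI] (1.74) p. 192: *«U_{k,Z} = U_{k,Z}(V_k) = U(𝔹_k(Z), M˙(Q_k^{s*}V_k)) … It is defined in each component of Z separately»*;
(1.77) p. 194: *«Consider the function V_k↾_Λ → A(U_{k,Z}(V_k)). (1.77) It is defined on configurations V_k satisfying mild regularity conditions,
e.g., |∂V_k − 1| < a₁ on Z»*; p. 193 ll. 17–20: *«The corresponding configuration U_{k,Z} satisfies the condition |∂U_{k,Z} − 1| < O(1)B₃M²εη²»*;
[Balaban1985Variational] (5) p. 278: *«A(U) = Σ_{p ⊂ Ω₀} …»* — print's action is the action over the SUPPORT of the variational problem.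

## LOCATED-FARFIELD (self-audit of `B15Prop1GradientFromValue`, p533015 ∕ p534598)

The tree's (1.77) `B15Sect1Instances.fun177std bg M₁ Z k V = wilsonAction4 (bg.U (Bj M₁ Z k) (M˙(Q_k^{s*}V)))` (`fun177std_eq`,
`bgKZstd_apply`) is the Wilson action over ALL plaquettes of the torus (`Setup.wilsonAction4`) of the TOTAL solution map.  On the solvable set
that map is PINNED to the pull-back `Q_k^{s*}V` on every fine bond meeting `(maxDomT M₁ Z 1)ᶜ` — the scale-`0` member `Γ₀ = Ω₁(Z)ᶜ` of `𝔹_k(Z)`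
(`B14.Eq213DetSet.Bj_zero`, `0 < k`; `IsMinimizer` reads scale `0` through `Averaging.iter av 0 = id`).  Hence the typed (1.77) carries a FAR-FIELD
term — the action of `Q_k^{s*}V` over the plaquettes without a corner in `Ω₁(Z)` — which print's function (the action over the component of `Z`)
does not have.  The far term does not read the slice variables `B′` (under the geometric letter `hfar` below, print's regime `Λ ⊂⊂ Z`), so
Proposition 1's critical-orbit content and the gradient letter (L3) are unaffected; but it is NOT small at data rough off `Z`, so the order-zero
letter (V) `A(U_{k,Z}(ext V_k)) ≤ cA·ε²` of `B15Prop1GradientFromValue` (quantified over all `V_k` regular near `Z` only) is undischargeable for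
print-like data.  THIS FILE is the repair: the order-zero letter is asked of the NEAR-FIELD part of (1.77) only.

## What is here (kernel-checked, sorry-free; no `def`)

§1 Slice analysis (pure finite-dimensional): `continuousOn_of_cplx` (private; a real function with a complex-differentiable extension on the ball is
   continuous there); ★ `exists_sub_eq_const_of_dichotomy` (private) — if on the ball `‖X‖ < R` either `g X = 0 ∧ h X = 0` or `g X = h X + C` (`C ≥ 0`
   FIXED, `h ≥ 0`) and `g` is continuous, then `g − h` is CONSTANT on the ball (intermediate value theorem on segments: `g` takes no value in
   `(0, C)`); ★ `norm_rGrad_le_of_dichotomy` — then `‖∇g(0)‖ ≤ h(0)∕s + 8𝓐s∕R²` (`B15Prop1GradientFromValue.norm_rGrad_le_of_nonneg` applied to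
   `h = g − c` with the extension `G − c`, `|G − c| ≤ 2𝓐`); `norm_rGrad_sliceFn_le_of_dichotomy` — the same in print's gauge-fixed coordinates.
§2 ★★ `hJ_of_nearValue`, `exists_domain_prop1Printed_lfVarOn_ofFun_intrinsic_analytic_ofNearValue` — the bare-function endpoint of
   `B15Prop1IntrinsicOfFun` (p526992) with (L3) REPLACED by: a second family `fh i ≥ 0`, the dichotomy letter `hdich` (`f = fh + C` or `f = fh = 0`
   along the slice through `ext V_k`, `C ≥ 0` independent of the slice point) and the NEAR VALUE letter (Vn) `fh i (ext V_k) ≤ cA·ε²`.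
§3 AT `Node00.bgOfRecord av reg` — the far field split off BY PROOF: `wilsonLoc_one_cfg`, `wilsonAction4_one_cfg`, `plaqHol_congr_of_not_mem_plaqsOf`,
   `wilsonLoc_congr`, `isMinimizer_pinned` (a minimal configuration agrees with its scale-`0` datum off `Ω₁(Z)`), `far_letter_univ` (non-vacuity of `hfar`), `qsstarGIter0_expMul_ιA_of_far` (the pull-back off `Ω₁(Z)`
   does not read the slice, under `hfar`), ★★ `fun177std_dichotomy` (the dichotomy letter DISCHARGED at the record: `A = A_near + A_far(Q_k^{s*}V)`
   on the solvable set by `B16Sect1Wilson.eq115` + pinning, `A = A_near = 0` off it by `Node00.UminOfRecord_of_not`), ★★★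
   `exists_domain_prop1Printed_lfVarOn_std_su2_box_intrinsic_analytic_ofRecord_ofNearValue` — p527900's endpoint with (L3) replaced by (Vn)
   `wilsonLoc 1_{plaqsOf (maxDomT M₁ Z 1)} (U_{k,Z}(ext V_k)) ≤ cA·ε²` (print's p. 193 ll. 17–20 summed over the near plaquettes, `1 − Re tr U ≤
   ½|U − 1|²`), the geometric letter `hfar` («the k-blocks over `bondsOf Λ^{(k)}` lie inside `Ω₁(Z)`», print: `Λ` deep inside `Z`), `0 < k i`, and
   `hcJ' : 2cA·eR∕R + 4𝓐∕(R·eR) ≤ cJ`.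

## HONEST SCOPE

Count-neutral; (J1)∕(L2) stay NODE 00's letters ([15] Thm 1 ∕ Prop. 9; [LF-II] pp. 357–359); (Vn) is NODE 00's regularity (8) of `U_{k,Z}` on `Z`
summed — NOT proved here; the constant `4𝓐∕(R·eR)` still carries the polydisc bound of the TYPED total function (which absorbs the far term), a
locality trade against print's `B₃²4ε_k` stated in `B15Prop1GradientFromValue`; NOT a discharge of N12; nothing continuum ∕ OS ∕ mass-gap ∕ Clay.
No instance, no notation, no attribute, no definition.
-/

noncomputable section

open Set Finset Metric Filter
open scoped BigOperators Matrix RealInnerProductSpace Real InnerProductSpace Topology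

namespace Literature.MathematicalPhysics.QuantumFieldTheory.Balaban1983to89.B15Prop1GradientFromNearValue

open B15DeterminingSets GaugeField B16Sect1Backgrounds B15Prop1Carrier B8Eq17ClassAkV1
open B15Prop1SliceTaylorCalculus B15Prop1LocalLettersOfFun B15Prop1IntrinsicOfFun B15Prop1IntrinsicOfRecord B15Prop1GradientFromValue
open B15Prop1AnalyticExtClause (cplxVec cplxSlice anExt cplxSlice_apply norm_cplxSlice norm_cplxVec)
open B15Prop1ChartCalculusSU2 (E3)
open T4CubeChartGnomonic (SU2)
open B15Prop1ChartSU2 (su2Chart)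
open B15Prop1SliceCoordinates (GaugeSlice ιA freeBonds norm_ιA_apply_le mem_freeBonds ιA_apply_of_not_mem)
open T4AxialGaugeSmallField (castSite boxPlaqs)
open B6BondElimination (unitVec)
open B16Eq18Proof (box)
open B15Extension193 (extend)
open B15ShellGauge193 (shellGauge)
open B5Bounds167Lattice (formDk ofRealCfg)
open B14.Eq213DetSet B14.Eq216Concrete B15Sect1Instances B15Eq177GaugeInvariance B15Eq177ValueInvariance B16Sect1Wilson
open B14.Eq22Determines (blockIter)
open Literature.MathematicalPhysics.QuantumFieldTheory.BalabanImbrieJaffe1984to88.BIJ85Eq453GaugeField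
open B15Prop1ParametricZeroBranch (differentiableOn_section norm_prodMk_lt)

/-! ## §1 Slice analysis: a dichotomy `g = h + C ∨ g = h = 0` with `g` continuous makes `g − h` constant -/

section Slice

variable {P : Params} {k : ℕ} [DecidableEq (PBond P k)] (S : Set (Site P k)) (T : Finset (PBond P k))

/-- A real function on the slice agreeing on the ball `‖X‖ < R` with a complex-differentiable function of the complexified coordinates is
continuous on that ball (`g = re ∘ G ∘ ι` there). [folklore] -/
private theorem continuousOn_of_cplx {g : GaugeSlice S T E3 → ℝ} {G : GaugeSlice S T (EuclideanSpace ℂ (Fin 3)) → ℂ} {R : ℝ}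
    (hGd : DifferentiableOn ℂ G (ball 0 R)) (hagree : ∀ X : GaugeSlice S T E3, ‖X‖ < R → G (cplxSlice S T X) = (g X : ℂ)) :
    ContinuousOn g (ball 0 R) := by
  -- the `ContinuousSMul` instance of the doubly-`PiLp` slice along its normed-space path (instance search for it is slow)
  haveI : ContinuousSMul ℝ (GaugeSlice S T E3) := IsBoundedSMul.continuousSMul
  intro X hX
  rw [mem_ball_zero_iff] at hX
  have hopen : IsOpen {X' : GaugeSlice S T E3 | ‖X'‖ < R} := isOpen_lt continuous_norm continuous_const
  have hev : ∀ᶠ X' in 𝓝 X, G (cplxSlice S T X') = (g X' : ℂ) :=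
    Filter.eventually_of_mem (hopen.mem_nhds hX) fun X' hX' => hagree X' hX'
  have hGX : DifferentiableAt ℂ G (cplxSlice S T X) :=
    hGd.differentiableAt (isOpen_ball.mem_nhds (by rw [mem_ball_zero_iff, norm_cplxSlice]; exact hX))
  exact (differentiableAt_of_cplx S T hGX hev).continuousAt.continuousWithinAt

/-- ★ **A DICHOTOMY MAKES THE DIFFERENCE CONSTANT.**  On the ball `‖X‖ < R` let `g` be continuous and suppose that for a FIXED `C ≥ 0` and a function
`h ≥ 0`, at every point either `g X = 0 ∧ h X = 0` or `g X = h X + C`.  Then `g = h + c` on the whole ball for one constant `c ∈ [0, C]`.  (If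
`C > 0`, `g` takes no value in the open interval `(0, C)`; by the intermediate value theorem along the segment from `0` to `X` the alternative at `X`
is the alternative at `0`.)  The model: `g` = the typed (1.77) along the slice, `h` = its near-field part, `C` = the far-field action of the
pull-back, the first alternative = the unsolvable case. [folklore] -/
private theorem exists_sub_eq_const_of_dichotomy {g h : GaugeSlice S T E3 → ℝ} {R C : ℝ} (hcont : ContinuousOn g (ball 0 R)) (hC : 0 ≤ C)
    (hh : ∀ X : GaugeSlice S T E3, ‖X‖ < R → 0 ≤ h X)
    (hdich : ∀ X : GaugeSlice S T E3, ‖X‖ < R → (g X = 0 ∧ h X = 0) ∨ g X = h X + C) :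
    ∃ c : ℝ, 0 ≤ c ∧ c ≤ C ∧ ∀ X : GaugeSlice S T E3, ‖X‖ < R → g X = h X + c := by
  by_cases hC0 : C = 0
  · refine ⟨0, le_rfl, hC, fun X hX => ?_⟩
    rcases hdich X hX with ⟨h1, h2⟩ | h1
    · rw [h1, h2, add_zero]
    · rw [h1, hC0]
  have hCpos : 0 < C := lt_of_le_of_ne hC (Ne.symm hC0)
  rcases le_or_gt R 0 with hR | hR
  · exact ⟨0, le_rfl, hC, fun X hX => absurd (hX.trans_le hR) (not_lt.2 (norm_nonneg X))⟩
  have h0R : ‖(0 : GaugeSlice S T E3)‖ < R := by rw [norm_zero]; exact hR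
  -- `g` takes no value strictly between `0` and `C`
  have noMid : ∀ X : GaugeSlice S T E3, ‖X‖ < R → ¬ (0 < g X ∧ g X < C) := by
    intro X hX ⟨h1, h2⟩
    rcases hdich X hX with ⟨h3, _⟩ | h3
    · rw [h3] at h1; exact lt_irrefl _ h1
    · have := hh X hX; linarith
  -- the segment `t ↦ t • X`, `t ∈ [0, 1]`, stays in the ball and `g` is continuous along it
  haveI : ContinuousSMul ℝ (GaugeSlice S T E3) := IsBoundedSMul.continuousSMul
  have hpath : ∀ X : GaugeSlice S T E3, ‖X‖ < R → ContinuousOn (fun t : ℝ => g (t • X)) (Icc 0 1) := by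
    intro X hX
    have hc : ContinuousOn (g ∘ fun t : ℝ => t • X) (Icc 0 1) := by
      refine hcont.comp (continuous_id.smul continuous_const).continuousOn fun t ht => ?_
      show t • X ∈ ball (0 : GaugeSlice S T E3) R
      rw [mem_ball_zero_iff, norm_smul, Real.norm_of_nonneg ht.1]
      calc t * ‖X‖ ≤ 1 * ‖X‖ := mul_le_mul_of_nonneg_right ht.2 (norm_nonneg X)
        _ < R := by rw [one_mul]; exact hX
    exact hc
  -- along the segment one cannot pass from the value `0` to a value `≥ C`, nor back
  have noJumpUp : ∀ X : GaugeSlice S T E3, ‖X‖ < R → g 0 = 0 → ¬ C ≤ g X := by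
    intro X hX hg0 hgX
    have hivt := intermediate_value_Icc (zero_le_one' ℝ) (hpath X hX)
    have hmem : C / 2 ∈ Icc (g ((0 : ℝ) • X)) (g ((1 : ℝ) • X)) := by
      rw [zero_smul, one_smul, hg0]; constructor <;> linarith
    obtain ⟨t, ht, hgt⟩ := hivt hmem
    have htX : ‖t • X‖ < R := by
      rw [norm_smul, Real.norm_of_nonneg ht.1]
      calc t * ‖X‖ ≤ 1 * ‖X‖ := mul_le_mul_of_nonneg_right ht.2 (norm_nonneg X)
        _ < R := by rw [one_mul]; exact hX
    have hgt' : g (t • X) = C / 2 := hgt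
    exact noMid (t • X) htX ⟨by rw [hgt']; linarith, by rw [hgt']; linarith⟩
  have noJumpDown : ∀ X : GaugeSlice S T E3, ‖X‖ < R → C ≤ g 0 → ¬ g X = 0 := by
    intro X hX hg0 hgX
    have hivt := intermediate_value_Icc' (zero_le_one' ℝ) (hpath X hX)
    have hmem : C / 2 ∈ Icc (g ((1 : ℝ) • X)) (g ((0 : ℝ) • X)) := by
      rw [zero_smul, one_smul, hgX]; constructor <;> linarith
    obtain ⟨t, ht, hgt⟩ := hivt hmem
    have htX : ‖t • X‖ < R := by
      rw [norm_smul, Real.norm_of_nonneg ht.1]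
      calc t * ‖X‖ ≤ 1 * ‖X‖ := mul_le_mul_of_nonneg_right ht.2 (norm_nonneg X)
        _ < R := by rw [one_mul]; exact hX
    have hgt' : g (t • X) = C / 2 := hgt
    exact noMid (t • X) htX ⟨by rw [hgt']; linarith, by rw [hgt']; linarith⟩
  -- the alternative at `0` decides the constant
  rcases hdich 0 h0R with ⟨hg0, _⟩ | hg0
  · refine ⟨0, le_rfl, hC, fun X hX => ?_⟩
    rcases hdich X hX with ⟨h1, h2⟩ | h1
    · rw [h1, h2, add_zero]
    · exact absurd (show C ≤ g X by have := hh X hX; linarith) (noJumpUp X hX hg0)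
  · have hCg0 : C ≤ g 0 := by have := hh 0 h0R; linarith
    refine ⟨C, hC, le_rfl, fun X hX => ?_⟩
    rcases hdich X hX with ⟨h1, _⟩ | h1
    · exact absurd h1 (noJumpDown X hX hCg0)
    · exact h1

/-- ★ **THE GRADIENT UNDER THE DICHOTOMY.**  Let `g : GaugeSlice S T ℝ³ → ℝ` have a complex-differentiable extension `G` to the ball of radius `R` of the
complexified slice, bounded by `𝓐` there (`G(ιX) = g(X)` for `‖X‖ < R`), and let `h ≥ 0`, `C ≥ 0` satisfy the dichotomy `g X = 0 ∧ h X = 0` or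
`g X = h X + C` at every `‖X‖ < R`.  Then for every `0 < s < R`:  `‖∇g(0)‖ ≤ h(0)∕s + 8𝓐s∕R²`.  (`g = h + c` on the ball by
`exists_sub_eq_const_of_dichotomy`, so `∇g(0) = ∇h(0)`; `h` has the extension `G − c` with `|G − c| ≤ 𝓐 + c ≤ 2𝓐` since `c ≤ g(0) = |G(0)| ≤ 𝓐`;
then `B15Prop1GradientFromValue.norm_rGrad_le_of_nonneg`.) [cite: Balaban1989LargeFieldII, (1.11) p.358, (1.13) p.359 («it can be bounded by
2γ₀⁻¹2d(100M)⁵B₃²4ε_k»)] -/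
theorem norm_rGrad_le_of_dichotomy {g h : GaugeSlice S T E3 → ℝ} {G : GaugeSlice S T (EuclideanSpace ℂ (Fin 3)) → ℂ} {R 𝓐 C s : ℝ}
    (hGd : DifferentiableOn ℂ G (ball 0 R)) (hGb : ∀ Y ∈ ball (0 : GaugeSlice S T (EuclideanSpace ℂ (Fin 3))) R, ‖G Y‖ ≤ 𝓐)
    (hagree : ∀ X : GaugeSlice S T E3, ‖X‖ < R → G (cplxSlice S T X) = (g X : ℂ))
    (hh : ∀ X : GaugeSlice S T E3, ‖X‖ < R → 0 ≤ h X) (hC : 0 ≤ C)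
    (hdich : ∀ X : GaugeSlice S T E3, ‖X‖ < R → (g X = 0 ∧ h X = 0) ∨ g X = h X + C) (hs : 0 < s) (hsR : s < R) :
    ‖rGrad S T g 0‖ ≤ h 0 / s + 8 * 𝓐 * s / R ^ 2 := by
  have hR : 0 < R := hs.trans hsR
  have h0R : ‖(0 : GaugeSlice S T E3)‖ < R := by rw [norm_zero]; exact hR
  obtain ⟨c, hc0, _, hgc⟩ :=
    exists_sub_eq_const_of_dichotomy S T (continuousOn_of_cplx S T hGd hagree) hC hh hdich
  -- `c ≤ g 0 = ‖G 0‖ ≤ 𝓐`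
  have hG0 : G 0 = (g 0 : ℂ) := by
    have h := hagree 0 h0R
    rwa [map_zero] at h
  have hg0 : 0 ≤ g 0 := by rw [hgc 0 h0R]; exact add_nonneg (hh 0 h0R) hc0
  have hc𝓐 : c ≤ 𝓐 := by
    have h1 : ‖G 0‖ ≤ 𝓐 := hGb 0 (mem_ball_self hR)
    rw [hG0, Complex.norm_real, Real.norm_of_nonneg hg0] at h1
    have h2 : c ≤ g 0 := by rw [hgc 0 h0R]; linarith [hh 0 h0R]
    exact h2.trans h1
  -- the extension `G − c` of `h`
  have hGd' : DifferentiableOn ℂ (fun Y => G Y - (c : ℂ)) (ball 0 R) := hGd.sub_const _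
  have hGb' : ∀ Y ∈ ball (0 : GaugeSlice S T (EuclideanSpace ℂ (Fin 3))) R, ‖G Y - (c : ℂ)‖ ≤ 2 * 𝓐 := by
    intro Y hY
    calc ‖G Y - (c : ℂ)‖ ≤ ‖G Y‖ + ‖(c : ℂ)‖ := norm_sub_le _ _
      _ ≤ 𝓐 + c := add_le_add (hGb Y hY) (by rw [Complex.norm_real, Real.norm_of_nonneg hc0])
      _ ≤ 2 * 𝓐 := by linarith
  have hagree' : ∀ X : GaugeSlice S T E3, ‖X‖ < R → G (cplxSlice S T X) - (c : ℂ) = (h X : ℂ) := by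
    intro X hX
    rw [hagree X hX, hgc X hX]
    push_cast
    ring
  have hbound := norm_rGrad_le_of_nonneg S T hGd' hGb' hagree' hh hs hsR
  -- `∇g(0) = ∇h(0)` since `g = h + c` near `0`
  have hev : g =ᶠ[𝓝 (0 : GaugeSlice S T E3)] fun X => h X + c := by
    have hopen : IsOpen {X : GaugeSlice S T E3 | ‖X‖ < R} := isOpen_lt continuous_norm continuous_const
    exact Filter.eventually_of_mem (hopen.mem_nhds h0R) fun X hX => hgc X hX
  have hgrad : rGrad S T g 0 = rGrad S T h 0 := by
    simp only [rGrad, hev.fderiv_eq, fderiv_add_const]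
  rw [hgrad]
  calc ‖rGrad S T h 0‖ ≤ h 0 / s + 4 * (2 * 𝓐) * s / R ^ 2 := hbound
    _ = h 0 / s + 8 * 𝓐 * s / R ^ 2 := by ring

/-- ★ **THE SAME FOR PRINT'S FUNCTION IN THE GAUGE-FIXED COORDINATES.**  Let `G` be complex-differentiable on the sup-ball `‖B′‖ < R` of `𝔤ᶜ`-valued bond
fields, bounded by `𝓐`, with `G(cplxVec B′) = f(exp(iB′)·V)` for real `‖B′‖ < R`; let `fh ≥ 0` and `C ≥ 0` satisfy, at every slice point `X` with
`‖X‖ < R`, either `f(exp(i·ιA X)·V) = 0 ∧ fh(exp(i·ιA X)·V) = 0` or `f(exp(i·ιA X)·V) = fh(exp(i·ιA X)·V) + C`.  Then for `0 < s < R` the slice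
function `g = sliceFn S T f V` has `‖∇g(0)‖ ≤ fh(V)∕s + 8𝓐s∕R²`. [cite: Balaban1989LargeFieldII, (1.11) p.358, (1.13) p.359; Balaban1989LargeFieldI,
(1.77) p.194] -/
theorem norm_rGrad_sliceFn_le_of_dichotomy (f fh : GaugeField P k SU2 → ℝ) (V : GaugeField P k SU2) {R 𝓐 C s : ℝ}
    (G : VecField P k (EuclideanSpace ℂ (Fin 3)) → ℂ) (hGd : DifferentiableOn ℂ G (ball 0 R))
    (hGb : ∀ Y ∈ ball (0 : VecField P k (EuclideanSpace ℂ (Fin 3))) R, ‖G Y‖ ≤ 𝓐)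
    (hGr : ∀ B' : VecField P k E3, ‖B'‖ < R → G (cplxVec B') = ((f (expMul su2Chart B' V) : ℝ) : ℂ))
    (hfh : ∀ W : GaugeField P k SU2, 0 ≤ fh W) (hC : 0 ≤ C)
    (hdich : ∀ X : GaugeSlice S T E3, ‖X‖ < R →
      (f (expMul su2Chart (ιA S T X) V) = 0 ∧ fh (expMul su2Chart (ιA S T X) V) = 0) ∨
        f (expMul su2Chart (ιA S T X) V) = fh (expMul su2Chart (ιA S T X) V) + C)
    (hs : 0 < s) (hsR : s < R) :
    ‖rGrad S T (sliceFn S T f V) 0‖ ≤ fh V / s + 8 * 𝓐 * s / R ^ 2 := by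
  set Gs : GaugeSlice S T (EuclideanSpace ℂ (Fin 3)) → ℂ := fun Y' => G (ιAc S T Y') with hGs
  have hmaps : MapsTo (ιAc S T) (ball (0 : GaugeSlice S T (EuclideanSpace ℂ (Fin 3))) R) (ball 0 R) := by
    intro Y hY
    rw [mem_ball_zero_iff] at hY ⊢
    exact (norm_ιAc_le S T Y).trans_lt hY
  have hGsd : DifferentiableOn ℂ Gs (ball 0 R) := hGd.comp (ιAc S T).differentiable.differentiableOn hmaps
  have hGsb : ∀ Y ∈ ball (0 : GaugeSlice S T (EuclideanSpace ℂ (Fin 3))) R, ‖Gs Y‖ ≤ 𝓐 := fun Y hY => hGb _ (hmaps hY)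
  have hGsr : ∀ X : GaugeSlice S T E3, ‖X‖ < R → Gs (cplxSlice S T X) = ((sliceFn S T f V X : ℝ) : ℂ) := by
    intro X hX
    simp only [hGs, ιAc_cplxSlice, sliceFn_apply]
    exact hGr _ ((norm_ιA_le S T X).trans_lt hX)
  have hdich' : ∀ X : GaugeSlice S T E3, ‖X‖ < R →
      (sliceFn S T f V X = 0 ∧ sliceFn S T fh V X = 0) ∨ sliceFn S T f V X = sliceFn S T fh V X + C := by
    intro X hX
    simp only [sliceFn_apply]
    exact hdich X hX
  have h := norm_rGrad_le_of_dichotomy S T hGsd hGsb hGsr (fun X _ => by rw [sliceFn_apply]; exact hfh _) hC hdich' hs hsR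
  have h0 : sliceFn S T fh V 0 = fh V := by rw [sliceFn_apply, map_zero, expMul_zero]
  rwa [h0] at h

end Slice

/-! ## §2 (L3) from (J1), the dichotomy letter and the NEAR value letter (Vn), over a bare function family -/

section OfFun

open Classical

variable {P : Params}

/-- `cplxVec 0 = 0` (bookkeeping; private in `B15Prop1IntrinsicOfFun`). [folklore] -/
private theorem cplxVec_zero {k : ℕ} : cplxVec (0 : VecField P k E3) = 0 := by
  funext b; ext i; simp [cplxVec]

/-- ★★ **(L3) IN THE SHAPE THE CHAIN CONSUMES, FROM (J1) + THE DICHOTOMY + THE NEAR VALUE LETTER (Vn).**  Given the joint holomorphic extension `hGj`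
of `(p, B′) ↦ f i (exp(iB′)·ext(exp(ip)V_k))` with bound `𝓐 i` at `eR i`-regular data (letter (J1)), a family `fh i ≥ 0` such that along the slice
through `ext V_k` either `f i = fh i + C` (one `C ≥ 0` for the whole slice) or `f i = fh i = 0` (`hdich`), and (Vn) `fh i (ext V_k) ≤ cA·ε²` at
`ε`-regular data (`0 < ε ≤ eR i`), the slice gradient at `0` obeys `‖∇g(0)‖ ≤ cJ·ε` for every `cJ ≥ 2cA·eR i∕R i + 4𝓐 i∕(R i·eR i)` (test radius
`s = R i·ε∕(2eR i)` in `norm_rGrad_sliceFn_le_of_dichotomy` on the `p̃ = 0` section of `𝒢`).  Print's bound of the same gradient is `B₃²4ε_k`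
((1.13) p. 359). [cite: Balaban1989LargeFieldII, (1.11) p.358, (1.13) p.359; Balaban1989LargeFieldI, (1.77) p.194, p.193] -/
theorem hJ_of_nearValue {ι : Type} (Z Λ : ι → Set (Site P 0)) (k : ι → ℕ) (f fh : ∀ i, GaugeField P (k i) SU2 → ℝ)
    (hfh0 : ∀ i V, 0 ≤ fh i V) (eR : ι → ℝ) (heR : ∀ i, 0 < eR i) (T : ∀ i, Finset (PBond P (k i)))
    (ext : ∀ i, GaugeField P (k i) SU2 → GaugeField P (k i) SU2)
    {R 𝓐 : ι → ℝ} (hR : ∀ i, 0 < R i) {cA cJ : ℝ}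
    (hGj : ∀ i Vk, PlaqSmallOn (plaqsInside (pts (k i) (Z i ∩ (Λ i)ᶜ))) (eR i) Vk →
      ∃ 𝒢 : VecField P (k i) (EuclideanSpace ℂ (Fin 3)) × VecField P (k i) (EuclideanSpace ℂ (Fin 3)) → ℂ,
        DifferentiableOn ℂ 𝒢 (ball 0 (R i)) ∧
        (∀ z ∈ ball (0 : VecField P (k i) (EuclideanSpace ℂ (Fin 3)) × VecField P (k i) (EuclideanSpace ℂ (Fin 3))) (R i), ‖𝒢 z‖ ≤ 𝓐 i) ∧
        ∀ p B' : VecField P (k i) E3, ‖p‖ < R i → ‖B'‖ < R i →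
          𝒢 (cplxVec p, cplxVec B') = ((f i (expMul su2Chart B' (ext i (expMul su2Chart p Vk))) : ℝ) : ℂ))
    (hdich : ∀ i Vk, PlaqSmallOn (plaqsInside (pts (k i) (Z i ∩ (Λ i)ᶜ))) (eR i) Vk → ∃ C : ℝ, 0 ≤ C ∧
      ∀ X : GaugeSlice (pts (k i) (Λ i)) (T i) E3,
        (f i (expMul su2Chart (ιA (pts (k i) (Λ i)) (T i) X) (ext i Vk)) = 0 ∧
            fh i (expMul su2Chart (ιA (pts (k i) (Λ i)) (T i) X) (ext i Vk)) = 0) ∨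
          f i (expMul su2Chart (ιA (pts (k i) (Λ i)) (T i) X) (ext i Vk)) =
            fh i (expMul su2Chart (ιA (pts (k i) (Λ i)) (T i) X) (ext i Vk)) + C)
    (hVn : ∀ i ε Vk, 0 < ε → ε ≤ eR i → PlaqSmallOn (plaqsInside (pts (k i) (Z i ∩ (Λ i)ᶜ))) ε Vk → fh i (ext i Vk) ≤ cA * ε ^ 2)
    (hcJ' : ∀ i, 2 * cA * eR i / R i + 4 * 𝓐 i / (R i * eR i) ≤ cJ) :
    ∀ i ε Vk, 0 < ε → ε ≤ eR i → PlaqSmallOn (plaqsInside (pts (k i) (Z i ∩ (Λ i)ᶜ))) ε Vk →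
      ‖rGrad (pts (k i) (Λ i)) (T i) (sliceFn (pts (k i) (Λ i)) (T i) (f i) (ext i Vk)) 0‖ ≤ cJ * ε := by
  intro i ε Vk hε hεR hVk
  have hVR : PlaqSmallOn (plaqsInside (pts (k i) (Z i ∩ (Λ i)ᶜ))) (eR i) Vk := fun q hq => (hVk q hq).trans_le hεR
  obtain ⟨𝒢, hd, hb, hr⟩ := hGj i Vk hVR
  obtain ⟨C, hC, hdi⟩ := hdich i Vk hVR
  have h0R : ‖(0 : VecField P (k i) (EuclideanSpace ℂ (Fin 3)))‖ < R i := by rw [norm_zero]; exact hR i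
  have hGd : DifferentiableOn ℂ (fun B => 𝒢 (0, B)) (ball 0 (R i)) := differentiableOn_section 𝒢 hd h0R
  have hGb : ∀ Y ∈ ball (0 : VecField P (k i) (EuclideanSpace ℂ (Fin 3))) (R i), ‖𝒢 (0, Y)‖ ≤ 𝓐 i := fun Y hY =>
    hb _ (by rw [mem_ball_zero_iff] at hY ⊢; exact norm_prodMk_lt h0R hY)
  have hGr : ∀ B' : VecField P (k i) E3, ‖B'‖ < R i →
      𝒢 (0, cplxVec B') = ((f i (expMul su2Chart B' (ext i Vk)) : ℝ) : ℂ) := by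
    intro B' hB'
    have h := hr 0 B' (by rw [norm_zero]; exact hR i) hB'
    rwa [cplxVec_zero, expMul_zero] at h
  have hRi := hR i
  have heRi := heR i
  set s : ℝ := R i * ε / (2 * eR i) with hsdef
  have hs0 : 0 < s := by positivity
  have hsR : s < R i := by
    rw [hsdef, div_lt_iff₀ (by positivity)]
    nlinarith
  have h := norm_rGrad_sliceFn_le_of_dichotomy (pts (k i) (Λ i)) (T i) (f i) (fh i) (ext i Vk) (fun B => 𝒢 (0, B)) hGd hGb hGr
    (hfh0 i) hC (fun X _ => hdi X) hs0 hsR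
  have hfv : fh i (ext i Vk) ≤ cA * ε ^ 2 := hVn i ε Vk hε hεR hVk
  have hRne : R i ≠ 0 := hRi.ne'
  have heRne : eR i ≠ 0 := heRi.ne'
  have hεne : ε ≠ 0 := hε.ne'
  calc ‖rGrad (pts (k i) (Λ i)) (T i) (sliceFn (pts (k i) (Λ i)) (T i) (f i) (ext i Vk)) 0‖
      ≤ fh i (ext i Vk) / s + 8 * 𝓐 i * s / R i ^ 2 := h
    _ ≤ cA * ε ^ 2 / s + 8 * 𝓐 i * s / R i ^ 2 := add_le_add (div_le_div_of_nonneg_right hfv hs0.le) le_rfl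
    _ = (2 * cA * eR i / R i + 4 * 𝓐 i / (R i * eR i)) * ε := by
      rw [hsdef]
      field_simp
      ring
    _ ≤ cJ * ε := mul_le_mul_of_nonneg_right (hcJ' i) hε.le

/-- ★★ **PROPOSITION 1 [IV] WITH ITS ANALYTIC-EXTENSION CLAUSE, IN THE INTRINSIC READING, OVER A BARE FUNCTION FAMILY — WITH (L3) REPLACED BY THE
DICHOTOMY AND THE NEAR VALUE LETTER (Vn).**  The endpoint `B15Prop1IntrinsicOfFun.exists_domain_prop1Printed_lfVarOn_ofFun_intrinsic_analytic`
(p526992) VERBATIM, except that the gradient letter `hJ` is gone: in its place a second family `fh i ≥ 0`, the dichotomy letter `hdich`, (Vn)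
`hVn : fh i (ext i V_k) ≤ cA·ε²` at `ε`-regular data and `hcJ' : 2cA·eR i∕R i + 4𝓐 i∕(R i·eR i) ≤ cJ` (`hJ_of_nearValue`).  Letters left: (J1) `hGj`,
(L2) `hlead` + `hsm`∕`hγle`, `hdich`, (Vn), `hf`, structure. [cite: Balaban1989LargeFieldI, Prop. 1 (1.77)–(1.78) p.194 (incl. the last clause), p.193;
Balaban1989LargeFieldII, (1.7)–(1.9) p.358, (1.11) p.358, (1.12)–(1.13) p.359; Balaban1985Variational, Prop. 9 p.309] -/
theorem exists_domain_prop1Printed_lfVarOn_ofFun_intrinsic_analytic_ofNearValue (hd3 : 3 ≤ P.d) (h0 : 0 < P.d) {ι : Type}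
    (Z Λ : ι → Set (Site P 0)) (k : ι → ℕ) (M : ι → ℝ)
    (f : ∀ i, GaugeField P (k i) SU2 → ℝ)
    (hf : ∀ i (u : GaugeTransf P (k i) SU2) (V : GaugeField P (k i) SU2), f i (gaugeAct u V) = f i V)
    (eR : ι → ℝ) (heR : ∀ i, 0 < eR i)
    (T : ∀ i, Finset (PBond P (k i)))
    (lo hi : ι → Fin P.d → ℤ) (n : ι → ℕ) (hn : ∀ i κ, hi i κ ≤ lo i κ + n i) (hN : ∀ i, n i + 2 < P.sitesPerDir (k i))
    (hbox : ∀ i, pts (k i) (Λ i) = (castSite '' Set.Icc (lo i) (hi i) : Set (Site P (k i))))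
    (hZ : ∀ i, (boxPlaqs (lo i - 1) (hi i + 1) : Set (Plaq P (k i))) ⊆ plaqsInside (pts (k i) (Z i)))
    (hTG0 : ∀ i, T i = @Finset.image (Fin P.d → ℤ) (PBond P (k i)) (fun a b => Classical.propDecidable (a = b))
      (fun x => (⟨castSite (x - unitVec ⟨0, h0⟩), ⟨0, h0⟩⟩ : PBond P (k i))) (box (fun κ => (hi i κ - lo i κ + 1).toNat) (lo i)))
    (hN5 : ∀ i κ, ((hi i κ - lo i κ + 1).toNat : ℤ) + 5 < P.sitesPerDir (k i))
    (K : ι → ℕ) (hK1 : ∀ i, 1 ≤ K i) (hKn : ∀ i κ, (hi i κ - lo i κ + 1).toNat ≤ K i)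
    (ext : ∀ i, GaugeField P (k i) SU2 → GaugeField P (k i) SU2)
    (hext : ∀ i Vk, ext i Vk = extend (pts (k i) (Λ i)) (shellGauge Vk (lo i) (hi i)) Vk)
    (hlohi : ∀ i, lo i ≤ hi i)
    {γ cJ bx : ℝ} (hγ : 0 < γ) (hcJ : 0 ≤ cJ) (hbx : 0 ≤ bx)
    (hbxM : ∀ i, 12 * (P.d : ℝ) * ((n i : ℝ) + 2) ^ 2 ≤ bx * (M i) ^ 2)
    {Cerr R 𝓐 : ι → ℝ} (hM : ∀ i, 1 ≤ (M i)) (hR : ∀ i, 0 < R i) (h𝓐 : ∀ i, 0 ≤ 𝓐 i)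
    (n' : ι → ℕ) (hn' : ∀ i, 1 ≤ n' i)
    -- (J1) the JOINT holomorphic extension of the function in the datum perturbation and the field
    (hGj : ∀ i Vk, PlaqSmallOn (plaqsInside (pts (k i) (Z i ∩ (Λ i)ᶜ))) (eR i) Vk →
      ∃ 𝒢 : VecField P (k i) (EuclideanSpace ℂ (Fin 3)) × VecField P (k i) (EuclideanSpace ℂ (Fin 3)) → ℂ,
        DifferentiableOn ℂ 𝒢 (ball 0 (R i)) ∧
        (∀ z ∈ ball (0 : VecField P (k i) (EuclideanSpace ℂ (Fin 3)) × VecField P (k i) (EuclideanSpace ℂ (Fin 3))) (R i), ‖𝒢 z‖ ≤ 𝓐 i) ∧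
        ∀ p B' : VecField P (k i) E3, ‖p‖ < R i → ‖B'‖ < R i →
          𝒢 (cplxVec p, cplxVec B') = ((f i (expMul su2Chart B' (ext i (expMul su2Chart p Vk))) : ℝ) : ℂ))
    -- (L2) (1.7)–(1.9) p.358 for the Hessian of the slice function at `0`
    (hlead : ∀ i Vk, PlaqSmallOn (plaqsInside (pts (k i) (Z i ∩ (Λ i)ᶜ))) (eR i) Vk →
      ∀ X : GaugeSlice (pts (k i) (Λ i)) (T i) E3,
      |⟪X, (fderiv ℝ (rGrad (pts (k i) (Λ i)) (T i) (sliceFn (pts (k i) (Λ i)) (T i) (f i) (ext i Vk))) 0) X⟫ -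
          ∑ a : Fin 3, formDk (n' i) (fun _ : Fin P.d => P.sitesPerDir (k i))
            (ofRealCfg (fun _ : Fin P.d => P.sitesPerDir (k i)) fun j =>
              ιA (pts (k i) (Λ i)) (T i) X ⟨j.1, j.2⟩ a)| ≤ Cerr i * ‖X‖ ^ 2)
    (hsm : ∀ i, Cerr i ≤ (4 / Real.pi ^ 2) ^ (P.d + 2) / (2 * (3 * (K i : ℝ) ^ 2 + 2 * (K i : ℝ) ^ 4)))
    (hγle : ∀ i, γ / (M i) ^ 5 ≤ (4 / Real.pi ^ 2) ^ (P.d + 2) / (2 * (3 * (K i : ℝ) ^ 2 + 2 * (K i : ℝ) ^ 4)))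
    -- the NEAR part of the function, the dichotomy, and the NEAR value letter (Vn) (replace (L3))
    (fh : ∀ i, GaugeField P (k i) SU2 → ℝ) (hfh0 : ∀ i V, 0 ≤ fh i V)
    (hdich : ∀ i Vk, PlaqSmallOn (plaqsInside (pts (k i) (Z i ∩ (Λ i)ᶜ))) (eR i) Vk → ∃ C : ℝ, 0 ≤ C ∧
      ∀ X : GaugeSlice (pts (k i) (Λ i)) (T i) E3,
        (f i (expMul su2Chart (ιA (pts (k i) (Λ i)) (T i) X) (ext i Vk)) = 0 ∧
            fh i (expMul su2Chart (ιA (pts (k i) (Λ i)) (T i) X) (ext i Vk)) = 0) ∨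
          f i (expMul su2Chart (ιA (pts (k i) (Λ i)) (T i) X) (ext i Vk)) =
            fh i (expMul su2Chart (ιA (pts (k i) (Λ i)) (T i) X) (ext i Vk)) + C)
    {cA : ℝ}
    (hVn : ∀ i ε Vk, 0 < ε → ε ≤ eR i → PlaqSmallOn (plaqsInside (pts (k i) (Z i ∩ (Λ i)ᶜ))) ε Vk → fh i (ext i Vk) ≤ cA * ε ^ 2)
    (hcJ' : ∀ i, 2 * cA * eR i / R i + 4 * 𝓐 i / (R i * eR i) ≤ cJ)
    : ∃ a₁ : ι → ℝ, (∀ i, 0 < a₁ i) ∧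
      B15.Prop1Printed (lfVarOn su2Chart fun i =>
        (⟨⟨k i, Z i, Λ i, M i, f i, anExt (pts (k i) (Λ i)) (T i) (f i) (ext i)
          (min (1 / 2) (min (R i / 8) (γ / (M i) ^ 5 * (R i / 2) ^ 2 / (48 * (4 * 𝓐 i / R i + 1)))))⟩,
          domReg (Z i) (k i) (a₁ i)⟩ : InstOn P SU2)) :=
  exists_domain_prop1Printed_lfVarOn_ofFun_intrinsic_analytic hd3 h0 Z Λ k M f hf eR heR T lo hi n hn hN hbox hZ hTG0 hN5 K hK1 hKn
    ext hext hlohi hγ hcJ hbx hbxM hM hR h𝓐 n' hn' hGj hlead hsm hγle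
    (hJ_of_nearValue Z Λ k f fh hfh0 eR heR T ext hR hGj hdich hVn hcJ')

end OfFun

/-! ## §3 At `Node00.bgOfRecord av reg`: the far field of the typed (1.77) split off, and Proposition 1 from (J1), (L2), (Vn) -/

section Record

open Classical

variable {P : Params}

/-- The localized Wilson action `A(ζ, U) = Σ_p ζ(p)[1 − Re tr U(∂p)]` of the unit configuration `U ≡ 1` vanishes (every plaquette variable is `1`,
`Re tr 1 = 1`; bookkeeping of the printed definition). [cite: Balaban1987RG1, (0.2) p.252 (bookkeeping)] -/
theorem wilsonLoc_one_cfg {j : ℕ} {G : Type*} [GaugeGroup G] (ζ : Plaq P j → ℝ) :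
    wilsonLoc ζ (fun _ : PBond P j => (1 : G)) = 0 := by
  unfold wilsonLoc
  refine Finset.sum_eq_zero fun p _ => ?_
  have h : plaqHol (fun _ : PBond P j => (1 : G)) p = 1 := by simp [plaqHol]
  rw [h, GaugeGroup.reTr_one, sub_self, mul_zero]

/-- The Wilson action `A(U) = Σ_p [1 − Re tr U(∂p)]` of the unit configuration `U ≡ 1` vanishes (bookkeeping of the printed definition).
[cite: Balaban1987RG1, (0.2) p.252 (bookkeeping)] -/
theorem wilsonAction4_one_cfg {j : ℕ} {G : Type*} [GaugeGroup G] :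
    wilsonAction4 (fun _ : PBond P j => (1 : G)) = 0 := by
  rw [← wilsonLoc_one]
  exact wilsonLoc_one_cfg _

/-- Two configurations agreeing on every bond whose initial point lies outside a site set `Y` have the same plaquette variable at every plaquette
WITHOUT a corner in `Y` (the four bonds of such a plaquette start at corners). [cite: Balaban1985RegularSpaces, p.77 (convention before (1.5))] -/
theorem plaqHol_congr_of_not_mem_plaqsOf {j : ℕ} {G : Type*} [GaugeGroup G] {Y : Set (Site P j)} {U U' : GaugeField P j G}
    (hU : ∀ b : PBond P j, b.src ∉ Y → U b = U' b) {p : Plaq P j} (hp : p ∉ plaqsOf Y) : plaqHol U p = plaqHol U' p := by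
  simp only [mem_plaqsOf, not_or] at hp
  obtain ⟨h1, h2, h3, _⟩ := hp
  simp only [plaqHol, hU ⟨p.src, p.μ⟩ h1, hU ⟨p.src.shift p.μ, p.ν⟩ h2, hU ⟨p.src.shift p.ν, p.μ⟩ h3, hU ⟨p.src, p.ν⟩ h1]

/-- The localized Wilson action reads a configuration only through the plaquette variables on the support of the weight. [cite: Balaban1989LargeFieldII, (1.1) p.356] -/
theorem wilsonLoc_congr {j : ℕ} {G : Type*} [GaugeGroup G] (ζ : Plaq P j → ℝ) {U U' : GaugeField P j G}
    (h : ∀ p, ζ p ≠ 0 → plaqHol U p = plaqHol U' p) : wilsonLoc ζ U = wilsonLoc ζ U' := by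
  unfold wilsonLoc
  refine Finset.sum_congr rfl fun p _ => ?_
  by_cases hζ : ζ p = 0
  · rw [hζ, zero_mul, zero_mul]
  · rw [h p hζ]

/-- **THE SOLUTION MAP OF RECORD IS PINNED TO ITS SCALE-`0` DATUM OFF `Ω₁(Z)`**: a minimal configuration of (2.12) for `𝐁_k(Z)` and the data `M˙(W)`,
`0 < k`, agrees with `W` on every fine bond starting outside `Ω₁(Z) = maxDomT M₁ Z 1` (the constraint at scale `0` on `Γ₀ = Ω₁(Z)ᶜ`,
`B14.Eq213DetSet.Bj_zero`; [III] (1.12) p. 248 *«U = V₀ on Ω₁ᶜ»*). [cite: Balaban1988Convergent, (2.2) p.255, (2.12)–(2.13) p.256–257, (1.12) p.248] -/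
theorem isMinimizer_pinned {G : Type*} [GaugeGroup G] {av : ∀ j, Averaging P j G} {reg : Set (GaugeField P 0 G)} {M₁ : ℕ}
    {Z : Set (Site P 0)} {k : ℕ} (hk0 : 0 < k) {W U₀ : GaugeField P 0 G} (hmin : IsMinimizer av reg (Bj M₁ Z k) (avgFamily av W) U₀)
    (b : PBond P 0) (hb : b.src ∉ maxDomT M₁ Z 1) : U₀ b = W b := by
  have hb' : b ∈ bondsOf (Bj M₁ Z k 0) := by
    rw [Bj_zero hk0]
    exact Or.inl hb
  exact hmin.2.1 0 b hb'

/-- **THE PULL-BACK OFF `Ω₁(Z)` DOES NOT READ THE SLICE** under the geometric letter `hfar` («the k-blocks over the bonds meeting `Λ^{(k)}` lie inside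
`Ω₁(Z)`», print: `Λ` deep inside `Z`, [IV] p. 192–193): `Q_k^{s*}(exp(i·ιA X)·W) = Q_k^{s*}(W)` on every fine bond starting outside `Ω₁(Z)`
([III] (1.3): the corridor bond `b` reads the unit-lattice bond `⟨B^k(b₋), μ(b)⟩`, `B14.Eq216Concrete.qsstarGIter0_eq`; `ιA X` vanishes off the bonds
meeting `Λ^{(k)}`). [cite: Balaban1988Convergent, (1.3) p.246, (2.16) p.257; Balaban1989LargeFieldI, (1.74) p.192] -/
theorem qsstarGIter0_expMul_ιA_of_far {M₁ : ℕ} {Z Λ : Set (Site P 0)} {k : ℕ} (hk : k ≤ P.m + P.K) {T : Finset (PBond P k)}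
    (hfar : ∀ b : PBond P 0, b.src ∉ maxDomT M₁ Z 1 → (⟨blockIter k b.src, b.dir⟩ : PBond P k) ∉ bondsOf (pts k Λ))
    (X : GaugeSlice (pts k Λ) T E3) (W : GaugeField P k SU2) (b : PBond P 0) (hb : b.src ∉ maxDomT M₁ Z 1) :
    qsstarGIter0 k (expMul su2Chart (ιA (pts k Λ) T X) W) b = qsstarGIter0 k W b := by
  rw [qsstarGIter0_eq k hk, qsstarGIter0_eq k hk]
  split_ifs with hint
  · rfl
  · have hc : (⟨blockIter k b.src, b.dir⟩ : PBond P k) ∉ freeBonds (pts k Λ) T := fun h => hfar b hb (mem_freeBonds.1 h).1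
    show su2Chart.iexp (ιA (pts k Λ) T X ⟨blockIter k b.src, b.dir⟩) * W ⟨blockIter k b.src, b.dir⟩ = W ⟨blockIter k b.src, b.dir⟩
    rw [ιA_apply_of_not_mem X hc, su2Chart.iexp_zero, one_mul]

/-- NON-VACUITY of the geometric letter `hfar`: for `Z = T_η` (the whole torus; `Ω₁(T_η) = T_η`, `B14.Eq213DetSet.maxDomT_univ`) its premise is never
met, so the letter holds for every `Λ` and `k` (for a bounded `Z`, `B14.Eq213DetSet.image_innerN_two_subset_maxDomT` puts every point two layers of
`LM₁`-cubes inside `Z` into `Ω₁(Z)` — print's regime `Λ ⊂⊂ Z`). [cite: Balaban1988Convergent, (2.13) pp.256–257 (bookkeeping)] -/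
theorem far_letter_univ (M₁ : ℕ) {k : ℕ} (Λ : Set (Site P 0)) (b : PBond P 0) (hb : b.src ∉ maxDomT M₁ (Set.univ : Set (Site P 0)) 1) :
    (⟨blockIter k b.src, b.dir⟩ : PBond P k) ∉ bondsOf (pts k Λ) := by
  rw [maxDomT_univ] at hb
  exact absurd (Set.mem_univ _) hb

/-- ★★ **THE DICHOTOMY LETTER DISCHARGED AT NODE 00's SOLUTION MAP OF RECORD — the far field of the typed (1.77) split off.**  For `bg := Node00.bgOfRecord
av reg`, `0 < k ≤ m + K`, the geometric letter `hfar` and any datum `V`: with `A_near(U) = Σ_{p ∈ plaqsOf Ω₁(Z)} (1 − Re tr U(∂p))` (`B16Sect1Wilson.wilsonLoc`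
at the indicator weight) and `C = A_far(Q_k^{s*}V) ≥ 0`, at EVERY slice point `X` either the (1.74) problem for the datum `exp(i·ιA X)·V` is unsolvable
and `A(U_{k,Z}) = A_near(U_{k,Z}) = 0` (junk branch `Node00.UminOfRecord_of_not`), or it is solvable and `A(U_{k,Z}) = A_near(U_{k,Z}) + C` (`eq115`; the
far plaquettes read only pinned bonds, `isMinimizer_pinned`, and the pinned datum does not read `X`, `qsstarGIter0_expMul_ιA_of_far`).
[cite: Balaban1989LargeFieldI, (1.74) p.192 («It is defined in each component of Z separately»), (1.77) p.194; Balaban1985Variational, (5) p.278;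
Balaban1988Convergent, (2.12)–(2.13) p.256–257] -/
theorem fun177std_dichotomy (av : ∀ j, Averaging P j SU2) (reg : Set (GaugeField P 0 SU2)) (M₁ : ℕ) {Z Λ : Set (Site P 0)} {k : ℕ}
    (hk0 : 0 < k) (hk : k ≤ P.m + P.K) (T : Finset (PBond P k))
    (hfar : ∀ b : PBond P 0, b.src ∉ maxDomT M₁ Z 1 → (⟨blockIter k b.src, b.dir⟩ : PBond P k) ∉ bondsOf (pts k Λ))
    (V : GaugeField P k SU2) :
    ∃ C : ℝ, 0 ≤ C ∧ ∀ X : GaugeSlice (pts k Λ) T E3,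
      (fun177std (Node00.bgOfRecord av reg) M₁ Z k (expMul su2Chart (ιA (pts k Λ) T X) V) = 0 ∧
          wilsonLoc ((plaqsOf (maxDomT M₁ Z 1)).indicator fun _ => (1 : ℝ))
            (bgKZstd (Node00.bgOfRecord av reg) M₁ Z k (expMul su2Chart (ιA (pts k Λ) T X) V)) = 0) ∨
        fun177std (Node00.bgOfRecord av reg) M₁ Z k (expMul su2Chart (ιA (pts k Λ) T X) V) =
          wilsonLoc ((plaqsOf (maxDomT M₁ Z 1)).indicator fun _ => (1 : ℝ))
            (bgKZstd (Node00.bgOfRecord av reg) M₁ Z k (expMul su2Chart (ιA (pts k Λ) T X) V)) +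
          C := by
  -- the far weight `1 − 1_{near}` is nonnegative and vanishes on the near plaquettes
  have hζfar : ∀ p : Plaq P 0, 1 - (plaqsOf (maxDomT M₁ Z 1)).indicator (fun _ => (1 : ℝ)) p ≠ 0 → p ∉ plaqsOf (maxDomT M₁ Z 1) := by
    intro p hp hmem
    apply hp
    simp only [Set.indicator_of_mem hmem, sub_self]
  have hζle : ∀ p : Plaq P 0, 0 ≤ 1 - (plaqsOf (maxDomT M₁ Z 1)).indicator (fun _ => (1 : ℝ)) p := by
    intro p
    by_cases hmem : p ∈ plaqsOf (maxDomT M₁ Z 1)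
    · simp only [Set.indicator_of_mem hmem, sub_self, le_refl]
    · simp only [Set.indicator_of_notMem hmem, sub_zero, zero_le_one]
  refine ⟨wilsonLoc (fun p => 1 - (plaqsOf (maxDomT M₁ Z 1)).indicator (fun _ => (1 : ℝ)) p) (qsstarGIter0 k V),
    wilsonLoc_nonneg _ _ hζle, fun X => ?_⟩
  -- the background of the perturbed datum is the solution map of record at the data `M˙(Q_k^{s*}(exp(i·ιA X)·V))`
  have hU : bgKZstd (Node00.bgOfRecord av reg) M₁ Z k (expMul su2Chart (ιA (pts k Λ) T X) V) =
      Node00.UminOfRecord av reg (Bj M₁ Z k) (avgFamily av (qsstarGIter0 k (expMul su2Chart (ιA (pts k Λ) T X) V))) := by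
    rw [bgKZstd_apply, Node00.bgOfRecord_U]
  by_cases hsol : ∃ U₀, IsMinimizer av reg (Bj M₁ Z k) (avgFamily av (qsstarGIter0 k (expMul su2Chart (ιA (pts k Λ) T X) V))) U₀
  · -- solvable: total action = near action + far action of the pinned pull-back
    right
    have hmin := Node00.isMinimizer_UminOfRecord av reg hsol
    -- far plaquettes read only bonds starting outside `Ω₁(Z)`, where the minimiser is pinned to the datum, and the datum there does not read `X`
    have h1 : wilsonLoc (fun p => 1 - (plaqsOf (maxDomT M₁ Z 1)).indicator (fun _ => (1 : ℝ)) p)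
        (Node00.UminOfRecord av reg (Bj M₁ Z k) (avgFamily av (qsstarGIter0 k (expMul su2Chart (ιA (pts k Λ) T X) V)))) =
        wilsonLoc (fun p => 1 - (plaqsOf (maxDomT M₁ Z 1)).indicator (fun _ => (1 : ℝ)) p)
          (qsstarGIter0 k (expMul su2Chart (ιA (pts k Λ) T X) V)) :=
      wilsonLoc_congr _ fun p hp => plaqHol_congr_of_not_mem_plaqsOf (fun b hb => isMinimizer_pinned hk0 hmin b hb) (hζfar p hp)
    have h2 : wilsonLoc (fun p => 1 - (plaqsOf (maxDomT M₁ Z 1)).indicator (fun _ => (1 : ℝ)) p)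
        (qsstarGIter0 k (expMul su2Chart (ιA (pts k Λ) T X) V)) =
        wilsonLoc (fun p => 1 - (plaqsOf (maxDomT M₁ Z 1)).indicator (fun _ => (1 : ℝ)) p) (qsstarGIter0 k V) :=
      wilsonLoc_congr _ fun p hp =>
        plaqHol_congr_of_not_mem_plaqsOf (fun b hb => qsstarGIter0_expMul_ιA_of_far hk hfar X V b hb) (hζfar p hp)
    rw [fun177std_eq, hU, eq115 ((plaqsOf (maxDomT M₁ Z 1)).indicator fun _ => (1 : ℝ)), h1, h2]
  · -- unsolvable: the junk branch `1`, both actions vanish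
    left
    have h1 : Node00.UminOfRecord av reg (Bj M₁ Z k) (avgFamily av (qsstarGIter0 k (expMul su2Chart (ιA (pts k Λ) T X) V))) =
        fun _ => 1 := Node00.UminOfRecord_of_not av reg hsol
    rw [fun177std_eq, hU, h1]
    exact ⟨wilsonAction4_one_cfg, wilsonLoc_one_cfg _⟩

/-- ★★★ **PROPOSITION 1 [IV] WITH ITS ANALYTIC-EXTENSION CLAUSE AT NODE 00's SOLUTION MAP OF RECORD, WITH THE GRADIENT LETTER (L3) REPLACED BY THE NEAR
VALUE LETTER (Vn).**  The record endpoint `B15Prop1IntrinsicOfRecord.exists_domain_prop1Printed_lfVarOn_std_su2_box_intrinsic_analytic_ofRecord`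
(p527900) VERBATIM at `bg := Node00.bgOfRecord av reg`, except that `hJ` is gone: in its place (Vn) `hVn` — the NEAR-FIELD part of (1.77) at the
extended `ε`-regular datum, `Σ_{p ∈ plaqsOf Ω₁(Z)} (1 − Re tr U_{k,Z}(ext V_k)(∂p)) ≤ cA·ε²` (print's p. 193 ll. 17–20 *«|∂U_{k,Z} − 1| < O(1)B₃M²εη²»*
on `Z`, summed with `1 − Re tr U ≤ ½|U − 1|²`, `B10Eq5RegularAction.one_sub_reTr_le_specialUnitaryGroup`) — the geometric letter `hfar`, `0 < k i`,
and `hcJ' : 2cA·eR i∕R i + 4𝓐 i∕(R i·eR i) ≤ cJ`; the dichotomy is DISCHARGED (`fun177std_dichotomy`).  WHAT A CONSUMER SUPPLIES: (J1) `hGj`, (L2)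
`hlead` + `hsm`∕`hγle`, (Vn) `hVn` + `hcJ'`, `hfar`, the class invariance `hreg`, `0 < k i ≤ m + K`, structure. [cite: Balaban1989LargeFieldI,
Prop. 1 (1.77)–(1.78) p.194 (incl. the last clause), p.193, (1.74) p.192; Balaban1989LargeFieldII, (1.7)–(1.9) p.358, (1.11) p.358, (1.12)–(1.13)
p.359; Balaban1985Variational, (5) p.278, Thm 1 (8) p.279, Prop. 9 p.309] -/
theorem exists_domain_prop1Printed_lfVarOn_std_su2_box_intrinsic_analytic_ofRecord_ofNearValue (hd3 : 3 ≤ P.d) (h0 : 0 < P.d) {ι : Type}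
    (av : ∀ j, Averaging P j SU2) {reg : Set (GaugeField P 0 SU2)}
    (hreg : ∀ (w : GaugeTransf P 0 SU2) (U : GaugeField P 0 SU2), U ∈ reg → gaugeAct w U ∈ reg)
    (M₁ : ℕ) (Z Λ : ι → Set (Site P 0)) (k : ι → ℕ) (M : ι → ℝ) (hk0 : ∀ i, 0 < k i) (hk : ∀ i, k i ≤ P.m + P.K)
    (eR : ι → ℝ) (heR : ∀ i, 0 < eR i)
    (T : ∀ i, Finset (PBond P (k i)))
    (lo hi : ι → Fin P.d → ℤ) (n : ι → ℕ) (hn : ∀ i κ, hi i κ ≤ lo i κ + n i) (hN : ∀ i, n i + 2 < P.sitesPerDir (k i))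
    (hbox : ∀ i, pts (k i) (Λ i) = (castSite '' Set.Icc (lo i) (hi i) : Set (Site P (k i))))
    (hZ : ∀ i, (boxPlaqs (lo i - 1) (hi i + 1) : Set (Plaq P (k i))) ⊆ plaqsInside (pts (k i) (Z i)))
    (hTG0 : ∀ i, T i = @Finset.image (Fin P.d → ℤ) (PBond P (k i)) (fun a b => Classical.propDecidable (a = b))
      (fun x => (⟨castSite (x - unitVec ⟨0, h0⟩), ⟨0, h0⟩⟩ : PBond P (k i))) (box (fun κ => (hi i κ - lo i κ + 1).toNat) (lo i)))
    (hN5 : ∀ i κ, ((hi i κ - lo i κ + 1).toNat : ℤ) + 5 < P.sitesPerDir (k i))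
    (K : ι → ℕ) (hK1 : ∀ i, 1 ≤ K i) (hKn : ∀ i κ, (hi i κ - lo i κ + 1).toNat ≤ K i)
    (ext : ∀ i, GaugeField P (k i) SU2 → GaugeField P (k i) SU2)
    (hext : ∀ i Vk, ext i Vk = extend (pts (k i) (Λ i)) (shellGauge Vk (lo i) (hi i)) Vk)
    (hlohi : ∀ i, lo i ≤ hi i)
    {γ cJ bx : ℝ} (hγ : 0 < γ) (hcJ : 0 ≤ cJ) (hbx : 0 ≤ bx)
    (hbxM : ∀ i, 12 * (P.d : ℝ) * ((n i : ℝ) + 2) ^ 2 ≤ bx * (M i) ^ 2)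
    {Cerr R 𝓐 : ι → ℝ} (hM : ∀ i, 1 ≤ (M i)) (hR : ∀ i, 0 < R i) (h𝓐 : ∀ i, 0 ≤ 𝓐 i)
    (n' : ι → ℕ) (hn' : ∀ i, 1 ≤ n' i)
    -- (J1) the JOINT holomorphic extension of print's function in the datum perturbation and the field
    (hGj : ∀ i Vk, PlaqSmallOn (plaqsInside (pts (k i) (Z i ∩ (Λ i)ᶜ))) (eR i) Vk →
      ∃ 𝒢 : VecField P (k i) (EuclideanSpace ℂ (Fin 3)) × VecField P (k i) (EuclideanSpace ℂ (Fin 3)) → ℂ,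
        DifferentiableOn ℂ 𝒢 (ball 0 (R i)) ∧
        (∀ z ∈ ball (0 : VecField P (k i) (EuclideanSpace ℂ (Fin 3)) × VecField P (k i) (EuclideanSpace ℂ (Fin 3))) (R i), ‖𝒢 z‖ ≤ 𝓐 i) ∧
        ∀ p B' : VecField P (k i) E3, ‖p‖ < R i → ‖B'‖ < R i →
          𝒢 (cplxVec p, cplxVec B') =
            ((fun177std (Node00.bgOfRecord av reg) M₁ (Z i) (k i) (expMul su2Chart B' (ext i (expMul su2Chart p Vk))) : ℝ) : ℂ))
    -- (L2) (1.7)–(1.9) p.358 for the Hessian of the slice function at `0`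
    (hlead : ∀ i Vk, PlaqSmallOn (plaqsInside (pts (k i) (Z i ∩ (Λ i)ᶜ))) (eR i) Vk →
      ∀ X : GaugeSlice (pts (k i) (Λ i)) (T i) E3,
      |⟪X, (fderiv ℝ (rGrad (pts (k i) (Λ i)) (T i)
              (sliceFn (pts (k i) (Λ i)) (T i) (fun177std (Node00.bgOfRecord av reg) M₁ (Z i) (k i)) (ext i Vk))) 0) X⟫ -
          ∑ a : Fin 3, formDk (n' i) (fun _ : Fin P.d => P.sitesPerDir (k i))
            (ofRealCfg (fun _ : Fin P.d => P.sitesPerDir (k i)) fun j =>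
              ιA (pts (k i) (Λ i)) (T i) X ⟨j.1, j.2⟩ a)| ≤ Cerr i * ‖X‖ ^ 2)
    (hsm : ∀ i, Cerr i ≤ (4 / Real.pi ^ 2) ^ (P.d + 2) / (2 * (3 * (K i : ℝ) ^ 2 + 2 * (K i : ℝ) ^ 4)))
    (hγle : ∀ i, γ / (M i) ^ 5 ≤ (4 / Real.pi ^ 2) ^ (P.d + 2) / (2 * (3 * (K i : ℝ) ^ 2 + 2 * (K i : ℝ) ^ 4)))
    -- the geometric letter: the k-blocks over the bonds meeting `Λ^{(k)}` lie inside `Ω₁(Z)` (print: `Λ` deep inside `Z`)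
    (hfar : ∀ i (b : PBond P 0), b.src ∉ maxDomT M₁ (Z i) 1 → (⟨blockIter (k i) b.src, b.dir⟩ : PBond P (k i)) ∉ bondsOf (pts (k i) (Λ i)))
    -- (Vn) the NEAR-FIELD part of (1.77) at the extended regular datum is small (replaces (L3))
    {cA : ℝ}
    (hVn : ∀ i ε Vk, 0 < ε → ε ≤ eR i → PlaqSmallOn (plaqsInside (pts (k i) (Z i ∩ (Λ i)ᶜ))) ε Vk →
      wilsonLoc ((plaqsOf (maxDomT M₁ (Z i) 1)).indicator fun _ => (1 : ℝ))
        (bgKZstd (Node00.bgOfRecord av reg) M₁ (Z i) (k i) (ext i Vk)) ≤ cA * ε ^ 2)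
    (hcJ' : ∀ i, 2 * cA * eR i / R i + 4 * 𝓐 i / (R i * eR i) ≤ cJ)
    : ∃ a₁ : ι → ℝ, (∀ i, 0 < a₁ i) ∧
      B15.Prop1Printed (lfVarOn su2Chart fun i => InstOn.std (Node00.bgOfRecord av reg) M₁ (Z i) (Λ i) (k i) (M i) (a₁ i)
        (anExt (pts (k i) (Λ i)) (T i) (fun177std (Node00.bgOfRecord av reg) M₁ (Z i) (k i)) (ext i)
          (min (1 / 2) (min (R i / 8) (γ / (M i) ^ 5 * (R i / 2) ^ 2 / (48 * (4 * 𝓐 i / R i + 1))))))) :=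
  exists_domain_prop1Printed_lfVarOn_std_su2_box_intrinsic_analytic_ofRecord hd3 h0 av hreg M₁ Z Λ k M hk eR heR T lo hi n hn hN hbox
    hZ hTG0 hN5 K hK1 hKn ext hext hlohi hγ hcJ hbx hbxM hM hR h𝓐 n' hn' hGj hlead hsm hγle
    (hJ_of_nearValue Z Λ k (fun i => fun177std (Node00.bgOfRecord av reg) M₁ (Z i) (k i))
      (fun i V => wilsonLoc ((plaqsOf (maxDomT M₁ (Z i) 1)).indicator fun _ => (1 : ℝ)) (bgKZstd (Node00.bgOfRecord av reg) M₁ (Z i) (k i) V))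
      (fun _ _ => wilsonLoc_nonneg _ _ fun p => Set.indicator_nonneg (fun _ _ => zero_le_one) p) eR heR T ext hR hGj
      (fun i Vk _ => fun177std_dichotomy av reg M₁ (hk0 i) (hk i) (T i) (hfar i) (ext i Vk)) hVn hcJ')

end Record

/-! ## §4 (v1.1, lane owner dag-n12-c g23 — census axis U3 of `N12-UNIFORMITY-SPEC.md` §4 v2) The gradient letter through the NEAR value's OWN holomorphic extension

In §1–§3 the near value `h` (the action of `U_{k,Z}` over the plaquettes meeting `Ω₁(Z)`) is read through the extension `G − c` of the TOTAL typed (1.77), so the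
constant of the gradient letter is `8𝓐` with `𝓐` the bound of the TOTAL extension — in the road of record `𝓐 = |Plaq(T_η)|·(1 + 8𝓐₀⁴)`
(`B15Prop1JointHolomorphyFromBackground.norm_actionSum_le`), the TORUS plaquette count.  Print compares actions on the window only ([Balaban1989LargeFieldI] (1.77):
*«It is defined in each component of Z separately»*; [Balaban1989LargeFieldII] (1.2)–(1.6) p. 357).  THIS SECTION re-reads the same gradient through ANY bounded
holomorphic extension `H` of `h` ITSELF (bound `𝓐_S`): since `g = h + c` on the ball (§1's dichotomy lemma), `∇g(0) = ∇h(0)` and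
`B15Prop1GradientFromValue.norm_rGrad_le_of_nonneg` applies to `h` directly — `‖∇g(0)‖ ≤ h(0)∕s + 4𝓐_S·s∕R²`; the total extension is kept ONLY for the continuity of `g`
(no bound of it is read).  The natural `H` — the trace polynomial of a holomorphic configuration family summed over the near plaquette set `S` only, bound
`#S·(1 + 8𝓐₀⁴)` — is `B15Prop1JointHolomorphyFromBackground.jointHolomorphic_nearAction_of_cfgFamily` (v1.1 §5, p690184).  Endpoints: `hJ_of_nearValue_nearExt` ((L3) with
`hcJ' : 2cA·eR∕R + 2𝓐_S∕(R·eR) ≤ cJ`), the bare-function and the record Proposition-1 endpoints with the extra displayed letter (J1ˢ) `hGjS` (the near value's joint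
holomorphic extension, bound `𝓐S i`).  HONEST SCOPE: the analyticity radius of the clause `anExt` still reads the TOTAL bound `𝓐 i` (it comes from the joint implicit-function
step of `B15Prop1IntrinsicOfFun`, untouched here) — this section localises the GRADIENT letter's constant only; count-neutral; NOT a discharge of N12; nothing continuum ∕ OS ∕
mass-gap ∕ Clay.  Nothing landed is modified (append-only). -/

section NearExt

variable {P : Params} {k : ℕ} [DecidableEq (PBond P k)] (S : Set (Site P k)) (T : Finset (PBond P k))

/-- ★ **THE GRADIENT UNDER THE DICHOTOMY, THROUGH THE NEAR VALUE's OWN EXTENSION.**  Let `g : GaugeSlice S T ℝ³ → ℝ` be continuous on the ball `‖X‖ < R`, let `h ≥ 0`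
have a complex-differentiable extension `H` to the ball of radius `R` of the complexified slice, bounded by `𝓐_S` there (`H(ιX) = h(X)` for `‖X‖ < R`), and let `C ≥ 0`
satisfy the dichotomy `g X = 0 ∧ h X = 0` or `g X = h X + C` at every `‖X‖ < R`.  Then for every `0 < s < R`:  `‖∇g(0)‖ ≤ h(0)∕s + 4𝓐_S·s∕R²`.  (`g = h + c` on the ball by
§1's dichotomy lemma, so `∇g(0) = ∇h(0)`; then `B15Prop1GradientFromValue.norm_rGrad_le_of_nonneg` for `h` and `H`.)  Compared with `norm_rGrad_le_of_dichotomy`: the bound of the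
total extension is not read — only the continuity of `g`. [cite: Balaban1989LargeFieldII, (1.11) p.358, (1.13) p.359, (1.2)–(1.6) p.357; Balaban1989LargeFieldI, (1.77) p.194] -/
theorem norm_rGrad_le_of_dichotomy_nearExt {g h : GaugeSlice S T E3 → ℝ} {H : GaugeSlice S T (EuclideanSpace ℂ (Fin 3)) → ℂ} {R 𝓐S C s : ℝ}
    (hcont : ContinuousOn g (ball 0 R))
    (hHd : DifferentiableOn ℂ H (ball 0 R)) (hHb : ∀ Y ∈ ball (0 : GaugeSlice S T (EuclideanSpace ℂ (Fin 3))) R, ‖H Y‖ ≤ 𝓐S)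
    (hHagree : ∀ X : GaugeSlice S T E3, ‖X‖ < R → H (cplxSlice S T X) = (h X : ℂ))
    (hh : ∀ X : GaugeSlice S T E3, ‖X‖ < R → 0 ≤ h X) (hC : 0 ≤ C)
    (hdich : ∀ X : GaugeSlice S T E3, ‖X‖ < R → (g X = 0 ∧ h X = 0) ∨ g X = h X + C) (hs : 0 < s) (hsR : s < R) :
    ‖rGrad S T g 0‖ ≤ h 0 / s + 4 * 𝓐S * s / R ^ 2 := by
  have hR : 0 < R := hs.trans hsR
  have h0R : ‖(0 : GaugeSlice S T E3)‖ < R := by rw [norm_zero]; exact hR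
  obtain ⟨c, _, _, hgc⟩ := exists_sub_eq_const_of_dichotomy S T hcont hC hh hdich
  have hbound := norm_rGrad_le_of_nonneg S T hHd hHb hHagree hh hs hsR
  -- `∇g(0) = ∇h(0)` since `g = h + c` near `0`
  haveI : ContinuousSMul ℝ (GaugeSlice S T E3) := IsBoundedSMul.continuousSMul
  have hev : g =ᶠ[𝓝 (0 : GaugeSlice S T E3)] fun X => h X + c := by
    have hopen : IsOpen {X : GaugeSlice S T E3 | ‖X‖ < R} := isOpen_lt continuous_norm continuous_const
    exact Filter.eventually_of_mem (hopen.mem_nhds h0R) fun X hX => hgc X hX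
  have hgrad : rGrad S T g 0 = rGrad S T h 0 := by
    simp only [rGrad, hev.fderiv_eq, fderiv_add_const]
  rw [hgrad]
  exact hbound

/-- The same with the continuity of `g` supplied, as in §1, by a complex-differentiable extension `G` of `g` on the ball (NO bound of `G` is read).
[cite: Balaban1989LargeFieldII, (1.11) p.358, (1.13) p.359] -/
theorem norm_rGrad_le_of_dichotomy_nearExt' {g h : GaugeSlice S T E3 → ℝ} {G H : GaugeSlice S T (EuclideanSpace ℂ (Fin 3)) → ℂ} {R 𝓐S C s : ℝ}
    (hGd : DifferentiableOn ℂ G (ball 0 R)) (hagree : ∀ X : GaugeSlice S T E3, ‖X‖ < R → G (cplxSlice S T X) = (g X : ℂ))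
    (hHd : DifferentiableOn ℂ H (ball 0 R)) (hHb : ∀ Y ∈ ball (0 : GaugeSlice S T (EuclideanSpace ℂ (Fin 3))) R, ‖H Y‖ ≤ 𝓐S)
    (hHagree : ∀ X : GaugeSlice S T E3, ‖X‖ < R → H (cplxSlice S T X) = (h X : ℂ))
    (hh : ∀ X : GaugeSlice S T E3, ‖X‖ < R → 0 ≤ h X) (hC : 0 ≤ C)
    (hdich : ∀ X : GaugeSlice S T E3, ‖X‖ < R → (g X = 0 ∧ h X = 0) ∨ g X = h X + C) (hs : 0 < s) (hsR : s < R) :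
    ‖rGrad S T g 0‖ ≤ h 0 / s + 4 * 𝓐S * s / R ^ 2 :=
  norm_rGrad_le_of_dichotomy_nearExt S T (continuousOn_of_cplx S T hGd hagree) hHd hHb hHagree hh hC hdich hs hsR

/-- ★ **THE SAME FOR PRINT'S FUNCTION IN THE GAUGE-FIXED COORDINATES, THROUGH THE NEAR VALUE's OWN EXTENSION.**  As `norm_rGrad_sliceFn_le_of_dichotomy`, but the
bound is read off a complex-differentiable extension `H` of the NEAR value `B′ ↦ fh(exp(iB′)·V)` on the sup-ball `‖B′‖ < R` (bound `𝓐_S`); the extension `G` of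
`B′ ↦ f(exp(iB′)·V)` is kept for continuity only.  For `0 < s < R`: `‖∇(sliceFn S T f V)(0)‖ ≤ fh(V)∕s + 4𝓐_S·s∕R²`.
[cite: Balaban1989LargeFieldII, (1.11) p.358, (1.13) p.359, (1.2)–(1.6) p.357; Balaban1989LargeFieldI, (1.77) p.194] -/
theorem norm_rGrad_sliceFn_le_of_dichotomy_nearExt (f fh : GaugeField P k SU2 → ℝ) (V : GaugeField P k SU2) {R 𝓐S C s : ℝ}
    (G : VecField P k (EuclideanSpace ℂ (Fin 3)) → ℂ) (hGd : DifferentiableOn ℂ G (ball 0 R))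
    (hGr : ∀ B' : VecField P k E3, ‖B'‖ < R → G (cplxVec B') = ((f (expMul su2Chart B' V) : ℝ) : ℂ))
    (H : VecField P k (EuclideanSpace ℂ (Fin 3)) → ℂ) (hHd : DifferentiableOn ℂ H (ball 0 R))
    (hHb : ∀ Y ∈ ball (0 : VecField P k (EuclideanSpace ℂ (Fin 3))) R, ‖H Y‖ ≤ 𝓐S)
    (hHr : ∀ B' : VecField P k E3, ‖B'‖ < R → H (cplxVec B') = ((fh (expMul su2Chart B' V) : ℝ) : ℂ))
    (hfh : ∀ W : GaugeField P k SU2, 0 ≤ fh W) (hC : 0 ≤ C)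
    (hdich : ∀ X : GaugeSlice S T E3, ‖X‖ < R →
      (f (expMul su2Chart (ιA S T X) V) = 0 ∧ fh (expMul su2Chart (ιA S T X) V) = 0) ∨
        f (expMul su2Chart (ιA S T X) V) = fh (expMul su2Chart (ιA S T X) V) + C)
    (hs : 0 < s) (hsR : s < R) :
    ‖rGrad S T (sliceFn S T f V) 0‖ ≤ fh V / s + 4 * 𝓐S * s / R ^ 2 := by
  have hmaps : MapsTo (ιAc S T) (ball (0 : GaugeSlice S T (EuclideanSpace ℂ (Fin 3))) R) (ball 0 R) := by
    intro Y hY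
    rw [mem_ball_zero_iff] at hY ⊢
    exact (norm_ιAc_le S T Y).trans_lt hY
  set Gs : GaugeSlice S T (EuclideanSpace ℂ (Fin 3)) → ℂ := fun Y' => G (ιAc S T Y') with hGs
  set Hs : GaugeSlice S T (EuclideanSpace ℂ (Fin 3)) → ℂ := fun Y' => H (ιAc S T Y') with hHs
  have hGsd : DifferentiableOn ℂ Gs (ball 0 R) := hGd.comp (ιAc S T).differentiable.differentiableOn hmaps
  have hHsd : DifferentiableOn ℂ Hs (ball 0 R) := hHd.comp (ιAc S T).differentiable.differentiableOn hmaps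
  have hHsb : ∀ Y ∈ ball (0 : GaugeSlice S T (EuclideanSpace ℂ (Fin 3))) R, ‖Hs Y‖ ≤ 𝓐S := fun Y hY => hHb _ (hmaps hY)
  have hGsr : ∀ X : GaugeSlice S T E3, ‖X‖ < R → Gs (cplxSlice S T X) = ((sliceFn S T f V X : ℝ) : ℂ) := by
    intro X hX
    simp only [hGs, ιAc_cplxSlice, sliceFn_apply]
    exact hGr _ ((norm_ιA_le S T X).trans_lt hX)
  have hHsr : ∀ X : GaugeSlice S T E3, ‖X‖ < R → Hs (cplxSlice S T X) = ((sliceFn S T fh V X : ℝ) : ℂ) := by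
    intro X hX
    simp only [hHs, ιAc_cplxSlice, sliceFn_apply]
    exact hHr _ ((norm_ιA_le S T X).trans_lt hX)
  have hdich' : ∀ X : GaugeSlice S T E3, ‖X‖ < R →
      (sliceFn S T f V X = 0 ∧ sliceFn S T fh V X = 0) ∨ sliceFn S T f V X = sliceFn S T fh V X + C := by
    intro X hX
    simp only [sliceFn_apply]
    exact hdich X hX
  have h := norm_rGrad_le_of_dichotomy_nearExt' S T hGsd hGsr hHsd hHsb hHsr (fun X _ => by rw [sliceFn_apply]; exact hfh _) hC hdich' hs hsR
  have h0 : sliceFn S T fh V 0 = fh V := by rw [sliceFn_apply, map_zero, expMul_zero]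
  rwa [h0] at h

end NearExt

section OfFunNearExt

open Classical

variable {P : Params}

/-- ★★ **(L3) IN THE SHAPE THE CHAIN CONSUMES, FROM (J1) + (J1ˢ) + THE DICHOTOMY + THE NEAR VALUE LETTER (Vn) — THE GRADIENT CONSTANT IN THE NEAR CURRENCY.**
As `hJ_of_nearValue`, with ONE more displayed letter: (J1ˢ) `hGjS`, a joint holomorphic extension `𝒢ˢ` of the NEAR value `(p, B′) ↦ fh i (exp(iB′)·ext(exp(ip)V_k))`
on the ball of radius `R i`, bounded by `𝓐S i`.  The total extension (J1) `hGj` is read for continuity only; the conclusion `‖∇g(0)‖ ≤ cJ·ε` now holds for every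
`cJ ≥ 2cA·eR i∕R i + 2·𝓐S i∕(R i·eR i)` (test radius `s = R i·ε∕(2eR i)` in `norm_rGrad_sliceFn_le_of_dichotomy_nearExt` on the `p̃ = 0` sections of `𝒢` and `𝒢ˢ`).
With `𝓐S i := #S_i·(1 + 8𝓐₀ i⁴)`, `S_i` the near plaquettes (`B15Prop1JointHolomorphyFromBackground.jointHolomorphic_nearAction_of_cfgFamily`), no torus count is read by
the gradient letter. [cite: Balaban1989LargeFieldII, (1.11) p.358, (1.13) p.359, (1.2)–(1.6) p.357; Balaban1989LargeFieldI, (1.77) p.194, p.193] -/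
theorem hJ_of_nearValue_nearExt {ι : Type} (Z Λ : ι → Set (Site P 0)) (k : ι → ℕ) (f fh : ∀ i, GaugeField P (k i) SU2 → ℝ)
    (hfh0 : ∀ i V, 0 ≤ fh i V) (eR : ι → ℝ) (heR : ∀ i, 0 < eR i) (T : ∀ i, Finset (PBond P (k i)))
    (ext : ∀ i, GaugeField P (k i) SU2 → GaugeField P (k i) SU2)
    {R 𝓐 𝓐S : ι → ℝ} (hR : ∀ i, 0 < R i) {cA cJ : ℝ}
    (hGj : ∀ i Vk, PlaqSmallOn (plaqsInside (pts (k i) (Z i ∩ (Λ i)ᶜ))) (eR i) Vk →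
      ∃ 𝒢 : VecField P (k i) (EuclideanSpace ℂ (Fin 3)) × VecField P (k i) (EuclideanSpace ℂ (Fin 3)) → ℂ,
        DifferentiableOn ℂ 𝒢 (ball 0 (R i)) ∧
        (∀ z ∈ ball (0 : VecField P (k i) (EuclideanSpace ℂ (Fin 3)) × VecField P (k i) (EuclideanSpace ℂ (Fin 3))) (R i), ‖𝒢 z‖ ≤ 𝓐 i) ∧
        ∀ p B' : VecField P (k i) E3, ‖p‖ < R i → ‖B'‖ < R i →
          𝒢 (cplxVec p, cplxVec B') = ((f i (expMul su2Chart B' (ext i (expMul su2Chart p Vk))) : ℝ) : ℂ))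
    (hGjS : ∀ i Vk, PlaqSmallOn (plaqsInside (pts (k i) (Z i ∩ (Λ i)ᶜ))) (eR i) Vk →
      ∃ 𝒢S : VecField P (k i) (EuclideanSpace ℂ (Fin 3)) × VecField P (k i) (EuclideanSpace ℂ (Fin 3)) → ℂ,
        DifferentiableOn ℂ 𝒢S (ball 0 (R i)) ∧
        (∀ z ∈ ball (0 : VecField P (k i) (EuclideanSpace ℂ (Fin 3)) × VecField P (k i) (EuclideanSpace ℂ (Fin 3))) (R i), ‖𝒢S z‖ ≤ 𝓐S i) ∧
        ∀ p B' : VecField P (k i) E3, ‖p‖ < R i → ‖B'‖ < R i →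
          𝒢S (cplxVec p, cplxVec B') = ((fh i (expMul su2Chart B' (ext i (expMul su2Chart p Vk))) : ℝ) : ℂ))
    (hdich : ∀ i Vk, PlaqSmallOn (plaqsInside (pts (k i) (Z i ∩ (Λ i)ᶜ))) (eR i) Vk → ∃ C : ℝ, 0 ≤ C ∧
      ∀ X : GaugeSlice (pts (k i) (Λ i)) (T i) E3,
        (f i (expMul su2Chart (ιA (pts (k i) (Λ i)) (T i) X) (ext i Vk)) = 0 ∧
            fh i (expMul su2Chart (ιA (pts (k i) (Λ i)) (T i) X) (ext i Vk)) = 0) ∨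
          f i (expMul su2Chart (ιA (pts (k i) (Λ i)) (T i) X) (ext i Vk)) =
            fh i (expMul su2Chart (ιA (pts (k i) (Λ i)) (T i) X) (ext i Vk)) + C)
    (hVn : ∀ i ε Vk, 0 < ε → ε ≤ eR i → PlaqSmallOn (plaqsInside (pts (k i) (Z i ∩ (Λ i)ᶜ))) ε Vk → fh i (ext i Vk) ≤ cA * ε ^ 2)
    (hcJ' : ∀ i, 2 * cA * eR i / R i + 2 * 𝓐S i / (R i * eR i) ≤ cJ) :
    ∀ i ε Vk, 0 < ε → ε ≤ eR i → PlaqSmallOn (plaqsInside (pts (k i) (Z i ∩ (Λ i)ᶜ))) ε Vk →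
      ‖rGrad (pts (k i) (Λ i)) (T i) (sliceFn (pts (k i) (Λ i)) (T i) (f i) (ext i Vk)) 0‖ ≤ cJ * ε := by
  intro i ε Vk hε hεR hVk
  have hVR : PlaqSmallOn (plaqsInside (pts (k i) (Z i ∩ (Λ i)ᶜ))) (eR i) Vk := fun q hq => (hVk q hq).trans_le hεR
  obtain ⟨𝒢, hd, _, hr⟩ := hGj i Vk hVR
  obtain ⟨𝒢S, hdS, hbS, hrS⟩ := hGjS i Vk hVR
  obtain ⟨C, hC, hdi⟩ := hdich i Vk hVR
  have h0R : ‖(0 : VecField P (k i) (EuclideanSpace ℂ (Fin 3)))‖ < R i := by rw [norm_zero]; exact hR i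
  have hGd : DifferentiableOn ℂ (fun B => 𝒢 (0, B)) (ball 0 (R i)) := differentiableOn_section 𝒢 hd h0R
  have hHd : DifferentiableOn ℂ (fun B => 𝒢S (0, B)) (ball 0 (R i)) := differentiableOn_section 𝒢S hdS h0R
  have hHb : ∀ Y ∈ ball (0 : VecField P (k i) (EuclideanSpace ℂ (Fin 3))) (R i), ‖𝒢S (0, Y)‖ ≤ 𝓐S i := fun Y hY =>
    hbS _ (by rw [mem_ball_zero_iff] at hY ⊢; exact norm_prodMk_lt h0R hY)
  have hGr : ∀ B' : VecField P (k i) E3, ‖B'‖ < R i →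
      𝒢 (0, cplxVec B') = ((f i (expMul su2Chart B' (ext i Vk)) : ℝ) : ℂ) := by
    intro B' hB'
    have h := hr 0 B' (by rw [norm_zero]; exact hR i) hB'
    rwa [cplxVec_zero, expMul_zero] at h
  have hHr : ∀ B' : VecField P (k i) E3, ‖B'‖ < R i →
      𝒢S (0, cplxVec B') = ((fh i (expMul su2Chart B' (ext i Vk)) : ℝ) : ℂ) := by
    intro B' hB'
    have h := hrS 0 B' (by rw [norm_zero]; exact hR i) hB'
    rwa [cplxVec_zero, expMul_zero] at h
  have hRi := hR i
  have heRi := heR i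
  set s : ℝ := R i * ε / (2 * eR i) with hsdef
  have hs0 : 0 < s := by positivity
  have hsR : s < R i := by
    rw [hsdef, div_lt_iff₀ (by positivity)]
    nlinarith
  have h := norm_rGrad_sliceFn_le_of_dichotomy_nearExt (pts (k i) (Λ i)) (T i) (f i) (fh i) (ext i Vk) (fun B => 𝒢 (0, B)) hGd hGr
    (fun B => 𝒢S (0, B)) hHd hHb hHr (hfh0 i) hC (fun X _ => hdi X) hs0 hsR
  have hfv : fh i (ext i Vk) ≤ cA * ε ^ 2 := hVn i ε Vk hε hεR hVk
  have hRne : R i ≠ 0 := hRi.ne'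
  have heRne : eR i ≠ 0 := heRi.ne'
  have hεne : ε ≠ 0 := hε.ne'
  calc ‖rGrad (pts (k i) (Λ i)) (T i) (sliceFn (pts (k i) (Λ i)) (T i) (f i) (ext i Vk)) 0‖
      ≤ fh i (ext i Vk) / s + 4 * 𝓐S i * s / R i ^ 2 := h
    _ ≤ cA * ε ^ 2 / s + 4 * 𝓐S i * s / R i ^ 2 := add_le_add (div_le_div_of_nonneg_right hfv hs0.le) le_rfl
    _ = (2 * cA * eR i / R i + 2 * 𝓐S i / (R i * eR i)) * ε := by
      rw [hsdef]
      field_simp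
      ring
    _ ≤ cJ * ε := mul_le_mul_of_nonneg_right (hcJ' i) hε.le

/-- ★★ **PROPOSITION 1 [IV] WITH ITS ANALYTIC-EXTENSION CLAUSE, IN THE INTRINSIC READING, OVER A BARE FUNCTION FAMILY — (L3) FROM (Vn) WITH THE GRADIENT CONSTANT IN THE
NEAR CURRENCY.**  `exists_domain_prop1Printed_lfVarOn_ofFun_intrinsic_analytic_ofNearValue` (§2) VERBATIM, with ONE more displayed letter (J1ˢ) `hGjS` (the near value's joint
holomorphic extension, bound `𝓐S i`) and `hcJ'` re-keyed: `2cA·eR i∕R i + 2·𝓐S i∕(R i·eR i) ≤ cJ`.  HONEST SCOPE: the clause's analyticity radius still reads the total bound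
`𝓐 i` (joint implicit-function step of `B15Prop1IntrinsicOfFun`). [cite: Balaban1989LargeFieldI, Prop. 1 (1.77)–(1.78) p.194 (incl. the last clause), p.193;
Balaban1989LargeFieldII, (1.2)–(1.6) p.357, (1.7)–(1.9) p.358, (1.11) p.358, (1.12)–(1.13) p.359; Balaban1985Variational, Prop. 9 p.309] -/
theorem exists_domain_prop1Printed_lfVarOn_ofFun_intrinsic_analytic_ofNearValue_nearExt (hd3 : 3 ≤ P.d) (h0 : 0 < P.d) {ι : Type}
    (Z Λ : ι → Set (Site P 0)) (k : ι → ℕ) (M : ι → ℝ)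
    (f : ∀ i, GaugeField P (k i) SU2 → ℝ)
    (hf : ∀ i (u : GaugeTransf P (k i) SU2) (V : GaugeField P (k i) SU2), f i (gaugeAct u V) = f i V)
    (eR : ι → ℝ) (heR : ∀ i, 0 < eR i)
    (T : ∀ i, Finset (PBond P (k i)))
    (lo hi : ι → Fin P.d → ℤ) (n : ι → ℕ) (hn : ∀ i κ, hi i κ ≤ lo i κ + n i) (hN : ∀ i, n i + 2 < P.sitesPerDir (k i))
    (hbox : ∀ i, pts (k i) (Λ i) = (castSite '' Set.Icc (lo i) (hi i) : Set (Site P (k i))))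
    (hZ : ∀ i, (boxPlaqs (lo i - 1) (hi i + 1) : Set (Plaq P (k i))) ⊆ plaqsInside (pts (k i) (Z i)))
    (hTG0 : ∀ i, T i = @Finset.image (Fin P.d → ℤ) (PBond P (k i)) (fun a b => Classical.propDecidable (a = b))
      (fun x => (⟨castSite (x - unitVec ⟨0, h0⟩), ⟨0, h0⟩⟩ : PBond P (k i))) (box (fun κ => (hi i κ - lo i κ + 1).toNat) (lo i)))
    (hN5 : ∀ i κ, ((hi i κ - lo i κ + 1).toNat : ℤ) + 5 < P.sitesPerDir (k i))
    (K : ι → ℕ) (hK1 : ∀ i, 1 ≤ K i) (hKn : ∀ i κ, (hi i κ - lo i κ + 1).toNat ≤ K i)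
    (ext : ∀ i, GaugeField P (k i) SU2 → GaugeField P (k i) SU2)
    (hext : ∀ i Vk, ext i Vk = extend (pts (k i) (Λ i)) (shellGauge Vk (lo i) (hi i)) Vk)
    (hlohi : ∀ i, lo i ≤ hi i)
    {γ cJ bx : ℝ} (hγ : 0 < γ) (hcJ : 0 ≤ cJ) (hbx : 0 ≤ bx)
    (hbxM : ∀ i, 12 * (P.d : ℝ) * ((n i : ℝ) + 2) ^ 2 ≤ bx * (M i) ^ 2)
    {Cerr R 𝓐 𝓐S : ι → ℝ} (hM : ∀ i, 1 ≤ (M i)) (hR : ∀ i, 0 < R i) (h𝓐 : ∀ i, 0 ≤ 𝓐 i)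
    (n' : ι → ℕ) (hn' : ∀ i, 1 ≤ n' i)
    -- (J1) the JOINT holomorphic extension of the function in the datum perturbation and the field
    (hGj : ∀ i Vk, PlaqSmallOn (plaqsInside (pts (k i) (Z i ∩ (Λ i)ᶜ))) (eR i) Vk →
      ∃ 𝒢 : VecField P (k i) (EuclideanSpace ℂ (Fin 3)) × VecField P (k i) (EuclideanSpace ℂ (Fin 3)) → ℂ,
        DifferentiableOn ℂ 𝒢 (ball 0 (R i)) ∧
        (∀ z ∈ ball (0 : VecField P (k i) (EuclideanSpace ℂ (Fin 3)) × VecField P (k i) (EuclideanSpace ℂ (Fin 3))) (R i), ‖𝒢 z‖ ≤ 𝓐 i) ∧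
        ∀ p B' : VecField P (k i) E3, ‖p‖ < R i → ‖B'‖ < R i →
          𝒢 (cplxVec p, cplxVec B') = ((f i (expMul su2Chart B' (ext i (expMul su2Chart p Vk))) : ℝ) : ℂ))
    -- (L2) (1.7)–(1.9) p.358 for the Hessian of the slice function at `0`
    (hlead : ∀ i Vk, PlaqSmallOn (plaqsInside (pts (k i) (Z i ∩ (Λ i)ᶜ))) (eR i) Vk →
      ∀ X : GaugeSlice (pts (k i) (Λ i)) (T i) E3,
      |⟪X, (fderiv ℝ (rGrad (pts (k i) (Λ i)) (T i) (sliceFn (pts (k i) (Λ i)) (T i) (f i) (ext i Vk))) 0) X⟫ -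
          ∑ a : Fin 3, formDk (n' i) (fun _ : Fin P.d => P.sitesPerDir (k i))
            (ofRealCfg (fun _ : Fin P.d => P.sitesPerDir (k i)) fun j =>
              ιA (pts (k i) (Λ i)) (T i) X ⟨j.1, j.2⟩ a)| ≤ Cerr i * ‖X‖ ^ 2)
    (hsm : ∀ i, Cerr i ≤ (4 / Real.pi ^ 2) ^ (P.d + 2) / (2 * (3 * (K i : ℝ) ^ 2 + 2 * (K i : ℝ) ^ 4)))
    (hγle : ∀ i, γ / (M i) ^ 5 ≤ (4 / Real.pi ^ 2) ^ (P.d + 2) / (2 * (3 * (K i : ℝ) ^ 2 + 2 * (K i : ℝ) ^ 4)))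
    -- the NEAR part of the function, its joint holomorphic extension (J1ˢ), the dichotomy, and the NEAR value letter (Vn) (replace (L3))
    (fh : ∀ i, GaugeField P (k i) SU2 → ℝ) (hfh0 : ∀ i V, 0 ≤ fh i V)
    (hGjS : ∀ i Vk, PlaqSmallOn (plaqsInside (pts (k i) (Z i ∩ (Λ i)ᶜ))) (eR i) Vk →
      ∃ 𝒢S : VecField P (k i) (EuclideanSpace ℂ (Fin 3)) × VecField P (k i) (EuclideanSpace ℂ (Fin 3)) → ℂ,
        DifferentiableOn ℂ 𝒢S (ball 0 (R i)) ∧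
        (∀ z ∈ ball (0 : VecField P (k i) (EuclideanSpace ℂ (Fin 3)) × VecField P (k i) (EuclideanSpace ℂ (Fin 3))) (R i), ‖𝒢S z‖ ≤ 𝓐S i) ∧
        ∀ p B' : VecField P (k i) E3, ‖p‖ < R i → ‖B'‖ < R i →
          𝒢S (cplxVec p, cplxVec B') = ((fh i (expMul su2Chart B' (ext i (expMul su2Chart p Vk))) : ℝ) : ℂ))
    (hdich : ∀ i Vk, PlaqSmallOn (plaqsInside (pts (k i) (Z i ∩ (Λ i)ᶜ))) (eR i) Vk → ∃ C : ℝ, 0 ≤ C ∧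
      ∀ X : GaugeSlice (pts (k i) (Λ i)) (T i) E3,
        (f i (expMul su2Chart (ιA (pts (k i) (Λ i)) (T i) X) (ext i Vk)) = 0 ∧
            fh i (expMul su2Chart (ιA (pts (k i) (Λ i)) (T i) X) (ext i Vk)) = 0) ∨
          f i (expMul su2Chart (ιA (pts (k i) (Λ i)) (T i) X) (ext i Vk)) =
            fh i (expMul su2Chart (ιA (pts (k i) (Λ i)) (T i) X) (ext i Vk)) + C)
    {cA : ℝ}
    (hVn : ∀ i ε Vk, 0 < ε → ε ≤ eR i → PlaqSmallOn (plaqsInside (pts (k i) (Z i ∩ (Λ i)ᶜ))) ε Vk → fh i (ext i Vk) ≤ cA * ε ^ 2)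
    (hcJ' : ∀ i, 2 * cA * eR i / R i + 2 * 𝓐S i / (R i * eR i) ≤ cJ)
    : ∃ a₁ : ι → ℝ, (∀ i, 0 < a₁ i) ∧
      B15.Prop1Printed (lfVarOn su2Chart fun i =>
        (⟨⟨k i, Z i, Λ i, M i, f i, anExt (pts (k i) (Λ i)) (T i) (f i) (ext i)
          (min (1 / 2) (min (R i / 8) (γ / (M i) ^ 5 * (R i / 2) ^ 2 / (48 * (4 * 𝓐 i / R i + 1)))))⟩,
          domReg (Z i) (k i) (a₁ i)⟩ : InstOn P SU2)) :=
  exists_domain_prop1Printed_lfVarOn_ofFun_intrinsic_analytic hd3 h0 Z Λ k M f hf eR heR T lo hi n hn hN hbox hZ hTG0 hN5 K hK1 hKn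
    ext hext hlohi hγ hcJ hbx hbxM hM hR h𝓐 n' hn' hGj hlead hsm hγle
    (hJ_of_nearValue_nearExt Z Λ k f fh hfh0 eR heR T ext hR hGj hGjS hdich hVn hcJ')

end OfFunNearExt

section RecordNearExt

open Classical

variable {P : Params}

/-- ★★★ **PROPOSITION 1 [IV] WITH ITS ANALYTIC-EXTENSION CLAUSE AT NODE 00's SOLUTION MAP OF RECORD, (L3) FROM (Vn), THE GRADIENT CONSTANT IN THE NEAR CURRENCY.**
`exists_domain_prop1Printed_lfVarOn_std_su2_box_intrinsic_analytic_ofRecord_ofNearValue` (§3) VERBATIM at `bg := Node00.bgOfRecord av reg`, with ONE more displayed letter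
(J1ˢ) `hGjS`: a joint holomorphic extension, on the ball of radius `R i`, bounded by `𝓐S i`, of the NEAR value
`(p, B′) ↦ Σ_{q ∈ plaqsOf Ω₁(Z)} (1 − Re tr U_{k,Z}(exp(iB′)·ext(exp(ip)V_k))(∂q))` — inhabited in the road of record from the holomorphic minimiser family (J0′) by
`B15Prop1JointHolomorphyFromBackground.jointHolomorphic_nearAction_of_cfgFamily` with `𝓐S i = #plaqsOf(Ω₁(Z_i))·(1 + 8𝓐₀ i⁴)` (the NEAR plaquette count) — and `hcJ'`
re-keyed: `2cA·eR i∕R i + 2·𝓐S i∕(R i·eR i) ≤ cJ`.  The dichotomy is DISCHARGED (`fun177std_dichotomy`).  HONEST SCOPE: the clause's radius still reads the total `𝓐 i`;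
count-neutral; NOT a discharge of N12. [cite: Balaban1989LargeFieldI, Prop. 1 (1.77)–(1.78) p.194 (incl. the last clause), p.193, (1.74) p.192; Balaban1989LargeFieldII,
(1.2)–(1.6) p.357, (1.7)–(1.9) p.358, (1.11) p.358, (1.12)–(1.13) p.359; Balaban1985Variational, (5) p.278, Thm 1 (8) p.279, Prop. 9 p.309] -/
theorem exists_domain_prop1Printed_lfVarOn_std_su2_box_intrinsic_analytic_ofRecord_ofNearValue_nearExt (hd3 : 3 ≤ P.d) (h0 : 0 < P.d) {ι : Type}
    (av : ∀ j, Averaging P j SU2) {reg : Set (GaugeField P 0 SU2)}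
    (hreg : ∀ (w : GaugeTransf P 0 SU2) (U : GaugeField P 0 SU2), U ∈ reg → gaugeAct w U ∈ reg)
    (M₁ : ℕ) (Z Λ : ι → Set (Site P 0)) (k : ι → ℕ) (M : ι → ℝ) (hk0 : ∀ i, 0 < k i) (hk : ∀ i, k i ≤ P.m + P.K)
    (eR : ι → ℝ) (heR : ∀ i, 0 < eR i)
    (T : ∀ i, Finset (PBond P (k i)))
    (lo hi : ι → Fin P.d → ℤ) (n : ι → ℕ) (hn : ∀ i κ, hi i κ ≤ lo i κ + n i) (hN : ∀ i, n i + 2 < P.sitesPerDir (k i))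
    (hbox : ∀ i, pts (k i) (Λ i) = (castSite '' Set.Icc (lo i) (hi i) : Set (Site P (k i))))
    (hZ : ∀ i, (boxPlaqs (lo i - 1) (hi i + 1) : Set (Plaq P (k i))) ⊆ plaqsInside (pts (k i) (Z i)))
    (hTG0 : ∀ i, T i = @Finset.image (Fin P.d → ℤ) (PBond P (k i)) (fun a b => Classical.propDecidable (a = b))
      (fun x => (⟨castSite (x - unitVec ⟨0, h0⟩), ⟨0, h0⟩⟩ : PBond P (k i))) (box (fun κ => (hi i κ - lo i κ + 1).toNat) (lo i)))
    (hN5 : ∀ i κ, ((hi i κ - lo i κ + 1).toNat : ℤ) + 5 < P.sitesPerDir (k i))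
    (K : ι → ℕ) (hK1 : ∀ i, 1 ≤ K i) (hKn : ∀ i κ, (hi i κ - lo i κ + 1).toNat ≤ K i)
    (ext : ∀ i, GaugeField P (k i) SU2 → GaugeField P (k i) SU2)
    (hext : ∀ i Vk, ext i Vk = extend (pts (k i) (Λ i)) (shellGauge Vk (lo i) (hi i)) Vk)
    (hlohi : ∀ i, lo i ≤ hi i)
    {γ cJ bx : ℝ} (hγ : 0 < γ) (hcJ : 0 ≤ cJ) (hbx : 0 ≤ bx)
    (hbxM : ∀ i, 12 * (P.d : ℝ) * ((n i : ℝ) + 2) ^ 2 ≤ bx * (M i) ^ 2)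
    {Cerr R 𝓐 𝓐S : ι → ℝ} (hM : ∀ i, 1 ≤ (M i)) (hR : ∀ i, 0 < R i) (h𝓐 : ∀ i, 0 ≤ 𝓐 i)
    (n' : ι → ℕ) (hn' : ∀ i, 1 ≤ n' i)
    -- (J1) the JOINT holomorphic extension of print's function in the datum perturbation and the field
    (hGj : ∀ i Vk, PlaqSmallOn (plaqsInside (pts (k i) (Z i ∩ (Λ i)ᶜ))) (eR i) Vk →
      ∃ 𝒢 : VecField P (k i) (EuclideanSpace ℂ (Fin 3)) × VecField P (k i) (EuclideanSpace ℂ (Fin 3)) → ℂ,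
        DifferentiableOn ℂ 𝒢 (ball 0 (R i)) ∧
        (∀ z ∈ ball (0 : VecField P (k i) (EuclideanSpace ℂ (Fin 3)) × VecField P (k i) (EuclideanSpace ℂ (Fin 3))) (R i), ‖𝒢 z‖ ≤ 𝓐 i) ∧
        ∀ p B' : VecField P (k i) E3, ‖p‖ < R i → ‖B'‖ < R i →
          𝒢 (cplxVec p, cplxVec B') =
            ((fun177std (Node00.bgOfRecord av reg) M₁ (Z i) (k i) (expMul su2Chart B' (ext i (expMul su2Chart p Vk))) : ℝ) : ℂ))
    -- (J1ˢ) the JOINT holomorphic extension of the NEAR value, bounded by `𝓐S i` (the near count's currency)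
    (hGjS : ∀ i Vk, PlaqSmallOn (plaqsInside (pts (k i) (Z i ∩ (Λ i)ᶜ))) (eR i) Vk →
      ∃ 𝒢S : VecField P (k i) (EuclideanSpace ℂ (Fin 3)) × VecField P (k i) (EuclideanSpace ℂ (Fin 3)) → ℂ,
        DifferentiableOn ℂ 𝒢S (ball 0 (R i)) ∧
        (∀ z ∈ ball (0 : VecField P (k i) (EuclideanSpace ℂ (Fin 3)) × VecField P (k i) (EuclideanSpace ℂ (Fin 3))) (R i), ‖𝒢S z‖ ≤ 𝓐S i) ∧
        ∀ p B' : VecField P (k i) E3, ‖p‖ < R i → ‖B'‖ < R i →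
          𝒢S (cplxVec p, cplxVec B') =
            ((wilsonLoc ((plaqsOf (maxDomT M₁ (Z i) 1)).indicator fun _ => (1 : ℝ))
              (bgKZstd (Node00.bgOfRecord av reg) M₁ (Z i) (k i) (expMul su2Chart B' (ext i (expMul su2Chart p Vk)))) : ℝ) : ℂ))
    -- (L2) (1.7)–(1.9) p.358 for the Hessian of the slice function at `0`
    (hlead : ∀ i Vk, PlaqSmallOn (plaqsInside (pts (k i) (Z i ∩ (Λ i)ᶜ))) (eR i) Vk →
      ∀ X : GaugeSlice (pts (k i) (Λ i)) (T i) E3,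
      |⟪X, (fderiv ℝ (rGrad (pts (k i) (Λ i)) (T i)
              (sliceFn (pts (k i) (Λ i)) (T i) (fun177std (Node00.bgOfRecord av reg) M₁ (Z i) (k i)) (ext i Vk))) 0) X⟫ -
          ∑ a : Fin 3, formDk (n' i) (fun _ : Fin P.d => P.sitesPerDir (k i))
            (ofRealCfg (fun _ : Fin P.d => P.sitesPerDir (k i)) fun j =>
              ιA (pts (k i) (Λ i)) (T i) X ⟨j.1, j.2⟩ a)| ≤ Cerr i * ‖X‖ ^ 2)
    (hsm : ∀ i, Cerr i ≤ (4 / Real.pi ^ 2) ^ (P.d + 2) / (2 * (3 * (K i : ℝ) ^ 2 + 2 * (K i : ℝ) ^ 4)))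
    (hγle : ∀ i, γ / (M i) ^ 5 ≤ (4 / Real.pi ^ 2) ^ (P.d + 2) / (2 * (3 * (K i : ℝ) ^ 2 + 2 * (K i : ℝ) ^ 4)))
    -- the geometric letter: the k-blocks over the bonds meeting `Λ^{(k)}` lie inside `Ω₁(Z)` (print: `Λ` deep inside `Z`)
    (hfar : ∀ i (b : PBond P 0), b.src ∉ maxDomT M₁ (Z i) 1 → (⟨blockIter (k i) b.src, b.dir⟩ : PBond P (k i)) ∉ bondsOf (pts (k i) (Λ i)))
    -- (Vn) the NEAR-FIELD part of (1.77) at the extended regular datum is small (replaces (L3))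
    {cA : ℝ}
    (hVn : ∀ i ε Vk, 0 < ε → ε ≤ eR i → PlaqSmallOn (plaqsInside (pts (k i) (Z i ∩ (Λ i)ᶜ))) ε Vk →
      wilsonLoc ((plaqsOf (maxDomT M₁ (Z i) 1)).indicator fun _ => (1 : ℝ))
        (bgKZstd (Node00.bgOfRecord av reg) M₁ (Z i) (k i) (ext i Vk)) ≤ cA * ε ^ 2)
    (hcJ' : ∀ i, 2 * cA * eR i / R i + 2 * 𝓐S i / (R i * eR i) ≤ cJ)
    : ∃ a₁ : ι → ℝ, (∀ i, 0 < a₁ i) ∧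
      B15.Prop1Printed (lfVarOn su2Chart fun i => InstOn.std (Node00.bgOfRecord av reg) M₁ (Z i) (Λ i) (k i) (M i) (a₁ i)
        (anExt (pts (k i) (Λ i)) (T i) (fun177std (Node00.bgOfRecord av reg) M₁ (Z i) (k i)) (ext i)
          (min (1 / 2) (min (R i / 8) (γ / (M i) ^ 5 * (R i / 2) ^ 2 / (48 * (4 * 𝓐 i / R i + 1))))))) :=
  exists_domain_prop1Printed_lfVarOn_std_su2_box_intrinsic_analytic_ofRecord hd3 h0 av hreg M₁ Z Λ k M hk eR heR T lo hi n hn hN hbox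
    hZ hTG0 hN5 K hK1 hKn ext hext hlohi hγ hcJ hbx hbxM hM hR h𝓐 n' hn' hGj hlead hsm hγle
    (hJ_of_nearValue_nearExt Z Λ k (fun i => fun177std (Node00.bgOfRecord av reg) M₁ (Z i) (k i))
      (fun i V => wilsonLoc ((plaqsOf (maxDomT M₁ (Z i) 1)).indicator fun _ => (1 : ℝ)) (bgKZstd (Node00.bgOfRecord av reg) M₁ (Z i) (k i) V))
      (fun _ _ => wilsonLoc_nonneg _ _ fun p => Set.indicator_nonneg (fun _ _ => zero_le_one) p) eR heR T ext hR hGj hGjS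
      (fun i Vk _ => fun177std_dichotomy av reg M₁ (hk0 i) (hk i) (T i) (hfar i) (ext i Vk)) hVn hcJ')

end RecordNearExt

end Literature.MathematicalPhysics.QuantumFieldTheory.Balaban1983to89.B15Prop1GradientFromNearValue

end
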